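import Literature.MathematicalPhysics.QuantumFieldTheory.Balaban1983to89.T4ActivityLipschitz
import Literature.MathematicalPhysics.QuantumFieldTheory.Balaban1983to89.T4HistoryLipschitzOuter

/-!
# T4HistoryLipschitzActivity (v1.3) — the outer constant of the NE9 step inequality FROM KOTECKÝ–PREISS ANALYTICITY OF THE
ACTIVITIES IN THE POTENTIALS: `OutputLipschitz` (hence `OuterLipschitz`, hence NE9 ∧ FadingMemory) from a binder of the
printed TYPE of [Balaban1988RG2Cluster] (2.14)–(2.15)/(2.18)/(2.26)/(2.38), polymer by polymer, by the complex pencil through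
the two occurring potential configurations and the tree's pinned activity-Lipschitz theorem for truncated weights
(cell `pub-balaban`, T4-DAG §2 node U3 / §5 row T4-U3.E / §6 NE9; seat NE9-P2 gen 4, GAPS G-ne9p2-5; technique U4′ of the
seat's census: «per-activity analyticity + KP majorant instead of log-output analyticity»)

HONEST FRAMING (T4-DAG PAGE 1).  Rung (B)+1 on a FIXED finite torus — NOT infinite volume, NOT a mass gap, NOT the Clay
problem — and NOT a proof of NE9 for Bałaban's terms.  Every statement about [I] = [Balaban1987RG1] / [II] =
[Balaban1988RG2Cluster] below is a HYPOTHESIS SHAPE (a `def … : Prop` used as a binder) or a quotation locating the printed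
TYPE of such a shape; the theorems are kernel bookkeeping (complex analysis in one variable + the tree's cluster-expansion
estimates) over ABSTRACT carriers.  No internally-minted statement and no disputed step of the manuscripts enters as a fact.
Conditionals BetaPertH, (B), (B^μ) do not occur in this module (they live inside the window `W` and the binders of whoever
instantiates them, cell T4-DAG §6).

WHERE THIS SITS.  `T4HistoryLipschitzRecursion` §6 reduced the UNPRINTED one-step history-Lipschitz inequality to a linear
size bound of the localization channel (`ChannelSize`) and ONE outer binder `OuterLipschitz`; `T4HistoryLipschitzOuter` split
the latter into the explicit last-coupling modulus (`LastCouplingLipschitz`) and the Lipschitz dependence of the new term on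
the channel outputs (`OutputLipschitz`), and derived `OutputLipschitz … (fun k => 4·B₀ k/(R − s))` from ANALYTICITY + SIZE of
the WHOLE new-term map `Q ↦ A k s U X Q` on a ball of radius `R` of a complex normed space `Pot` of potential configurations
(§5 there, `outputLipschitz_of_analyticOn_ball`).  For Bałaban's (2.13) p. 14 of [II] — `𝐄^{(k+1)}(X) = Σ_n 1/n! Σ ρ^T
Π H(Z_i)`, a LOGARITHM of a polymer partition function — complex differentiability of the log-cluster sum on an
infinite-dimensional ball is not the printed statement: [II] prints analyticity and bounds for the ACTIVITIES `H(Z)` ((2.14),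
(2.15), Lemma 3 (2.38)) and then invokes the convergence theory of the Mayer expansion (p. 20 «The above lemma implies that
sufficient conditions for convergence of the series (2.12), (2.13) are satisfied, see [26, 67, 25, 50]»).  THIS LEAF moves
the outer binder to exactly that level:

POTENTIAL-KP (binder `ClusterGeom.PotentialKP`, §1; HYPOTHESIS SHAPE, asserted nowhere): the new term created at step k on a
scale-(k+1) domain `X` is the real part of a localized cluster sum `Σ_{K ∈ clus X} Φ^T(K; act k s U Q)` of an abstract
polymer gas (geometry `ClusterGeom`: polymers, incompatibility, step volumes, localizing families, pins — the sibling
`T4ActivityLipschitz.ClusterRep` without its two activity families) whose activities `act k s U Q γ` are, for every polymer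
`γ` of the step volume, COMPLEX DIFFERENTIABLE functions of the potential configuration `Q` on the ball `‖Q‖ < R₀` of `Pot`,
dominated there by a `Q`-INDEPENDENT majorant `m k s U γ` satisfying the `d`-weighted Kotecký–Preiss condition [KP86 (1)]
with size function `a` — at every coupling value `s = g_k` that occurs on the window.
Printed TYPE, one potential table (Bałaban's own `𝐕_k`), read from the renders of [II]: (2.14) p. 15 — the old terms enter a
term of `H(Z)` ONLY through the factor «·(−1)^{|P|}χ_{k,Y₀}(B)χ^c_{k,P}(B) exp[Σ_{Y∈𝐃} τ(Y)𝐕_k(Y,B)]», p. 15 «We consider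
it as an analytic function of (𝐔,𝐉) in the space 𝐔^c_{k+1}(X,α₀,α₁), and of the complex parameters σ(Z), τ.»; (2.15)
p. 15 bounds it by the same expression with «exp[Σ_{Y∈𝐃} |τ(Y)||𝐕_k(Y,B)|]»; p. 16 «The expression in the last
exponential can be estimated using (1.42), and the inequalities (1.43), (1.36). We take a small, positive number α₄, to
be chosen later, and 1/|τ(Y)| = E₀ε₁C₁α₄^{−1}M^q exp C₂κ₁ exp(−(1−3δ)κd_k(Y)). (2.18)» — the radius of analyticity in
the parameter multiplying a potential is the INVERSE OF THE POTENTIAL'S SIZE BOUND; (2.26) p. 17 «|(2.14)| ≤ exp(−(κ₁ −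
1)(LM)^{−4}|Z∖Z′₀|)·[Π_{Y∈𝐃} 2E₀ε₁C₁α₄^{−1}M^q exp C₂κ₁ exp(−(1−3δ)κd_k(Y))] exp(−½γ₂ε₁²g_k^{−2}|P|)·exp O(1)α₅|Z|»;
p. 18 «Assuming 2E₀ε₁C₁α₄^{−1}α₆^{−1}M^q exp C₂κ₁ exp 5κ ≤ 1»; Lemma 3 (2.38) p. 20 «|H(Z)| ≤ C₃ε₁ exp(−(1 −
8δ)½Lκd_{k+1}(Z))» with, p. 20, «We define the constant C₃ = 2(L + 2)⁴O(1)2E₀C₁α₄^{−1}α₆^{−1}M^q exp C₂κ₁.» — the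
activity bound is PROPORTIONAL to the uniform size constant E₀ of the old terms; and p. 20 «The above lemma implies that
sufficient conditions for convergence of the series (2.12), (2.13) are satisfied, see [26, 67, 25, 50].»  THIS SEAT'S
READING (recorded as a reading, not a fact): in a term of (2.14) the table enters only the last factor, so the INTEGRAND
of (2.14) — at fixed fluctuation field B, interpolation parameters s(Δ), t(Y) and contour parameters σ(Δ), τ(Y) — is «(table-
free factor) × exp(linear functional of the table)», the term itself — the average of these integrands against the (complex)
Gaussian measure dμ_{C^{(k)}(Z₀,σ(Z))}(B), dμ₀(X)|_Z and the parameter integrals Π∫ds∮dσ Π∫dt∮dτ — is an entire function of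
the table (differentiation under the integral sign, §7; v1 wrote «a term of (2.14) is the composition of the exponential
with a linear functional», which describes the integrand only — DOCFIX v1.1), and the chain (2.15) →
(2.26) → (2.38) uses the table only through its size ((1.36)/(1.42)–(1.43), the radius (2.18)) — so the same majorant serves
every table obeying the same size bound, i.e. a KP majorant UNIFORM on a ball of tables.  NOT PRINTED: (2.38) for potential
tables other than Bałaban's own `𝐕_k` (the uniformity over the ball), the norm of the table space, and — as everywhere in the
cell — anything comparing two coupling histories.  All of it is displayed as hypotheses below.

VERSIONS.  v1 (p186554, commit 6e91ccf9ddc4): §1–§6.  v1.1 (p186653, commit 181d6fb8d36c; same seat, gen 4): DOCFIX of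
the (2.14)-shape reading above (integrand vs. average) and in the §6 docstrings; APPEND-ONLY §7 (averaged exp-linear
activities); the CODE of §1–§6 is byte-identical to v1.  v1.2 (same seat, gen 4): APPEND-ONLY §8 (the Gâteaux form:
line-holomorphy binder `PotentialKPG`, the engine and all consequences re-derived from it, and POTENTIAL-KPG for averaged
activities under scalar measurability only); §1–§7 byte-identical to v1.1.  v1.3 (same seat, gen 4): APPEND-ONLY §8e
(evaluation-type functionals on the table space `S →ᵇ ℂ` discharge §8d's measurability and norm hypotheses:
`potentialKPG_of_avgEvalExpLinear`); §1–§8d byte-identical to v1.2.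

KERNEL CONTENT.
(§2) [folklore] `norm_clusterSum_sub_le_of_ballKP`: for an activity family `Q ↦ w Q` over a finite KP volume `L`, complex
differentiable polymer-by-polymer on the ball `‖Q‖ < R₀` under a `Q`-independent KP majorant, and two configurations of norm
`≤ s₀ < R₀`, the pinned localized cluster sums satisfy `‖E_{w Q}(𝒞) − E_{w Q′}(𝒞)‖ ≤ 4·a(γ)e^{−δ}/(R₀ − s₀)·‖Q − Q′‖`.
Proof: NEAR (‖Q − Q′‖ ≤ (R₀ − s₀)/2) — the affine pencil `z ↦ Q′ + z(Q − Q′)` (`T4ActivityLipschitz.inputPencil`) stays in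
the ball for `‖z‖ < (R₀ − s₀)/‖Q − Q′‖`, the activities along it are holomorphic and KP holds at EVERY point of the disc, so
the tree's pinned activity-Lipschitz theorem for truncated weights along holomorphic one-parameter families
(`T4ActivityLipschitz.norm_clusterSum_sub_le_of_family`: scalarised generating function, KP on the disc, Cauchy) gives
`a(γ)e^{−δ}/(radius − 1) ≤ 2a(γ)e^{−δ}‖Q − Q′‖/(R₀ − s₀)`; FAR — twice the pinned decay bound
(`T4ActivityLipschitz.norm_clusterSum_le_of_kp`) is `≤ 4a(γ)e^{−δ}‖Q − Q′‖/(R₀ − s₀)`.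
(§3) Over the carriers: POTENTIAL-KP ∧ DECAY EXTRACTION ∧ PIN BUDGET (`a(pin X)e^{−δ(X)} ≤ B₀ k·e^{−κd(X)}` on scale-(k+1)
domains) ∧ «the potential-dependent part of the new term IS the cluster sum read at `ρ k P`» ∧ «occurring configurations —
the hybrid ones `T k g′ (E g)`, g ≠ g′, included — have norm ≤ s₀ < R₀» ⇒ `OutputLipschitz E W T Ψ κ wt (fun k => 4·B₀ k/(R₀
− s₀))` (`outputLipschitz_of_potentialKP`) — the SAME constant as `T4HistoryLipschitzOuter` §5, so its radius conditions
`fade_of_radius` / `nonexpansive_of_radius` apply verbatim — and the size bound `‖new term‖ ≤ B₀ k·e^{−κd(X)}` on the ball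
(`norm_newTerm_le_of_potentialKP`).
(§4) The composed binders, by name: `outerLipschitz_of_potentialKP` (`T4HistoryLipschitzOuter.outerLipschitz_of_factorisation`)
and `ne9_and_fadingMemory_of_potentialKP` (`T4HistoryLipschitzRecursion.ne9_and_fadingMemory_of_linearChannel`): NE9 with the
product moduli of rate `ω + (4B/(R₀ − s₀))·τ̄` and `FadingMemory` of the same rate, every conditional displayed by name —
`ScaleZeroFree`, `AdmissibleTerms`, `ChannelAdditive`, `ChannelSize`, `Factorises`, `LastCouplingLipschitz`, POTENTIAL-KP,
`DecayExtract`, `PinBudget`, the reading map, the occurrence bound, and the numerical side conditions; and the same over the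
per-creation-step, sign-guarded channel binders of `T4HistoryLipschitzRecursion` §8 (v1.3) —
`ne9_and_fadingMemory_of_potentialKP_perStep` (`…ne9_and_fadingMemory_of_perStepNN`).
(§5) NON-VACUITY on a genuinely nonlinear recursion: one polymer with the LINEAR activity `μ·Q` — the new term is then the
one-polymer truncated weight `Φ^T({∙}; μ·E_k)` of the previous term (the Kotecký–Preiss logarithm, produced by the tree's
`clusterSum`, not postulated), `E_{k+1} = g_k + Re Φ^T({∙}; μE_k)`, `E_0 = 0`; for `0 ≤ μ`, `6μe ≤ 1` and histories with
`|g_i| ≤ ½`: POTENTIAL-KP with `R₀ = 6`, occurring size `s₀ = 3/2` (proved inductively from the KP decay bound itself), and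
§4 returns NE9 with moduli `(8/9)^{k−1−i}` and `FadingMemory (9/8) (8/9)` (`kpToy_ne9`).
(§6) The (2.14) → (2.15) majorant step in kernel, INTEGRAND level: activities «configuration-free prefactor × exp(continuous
linear functional of the configuration)» (`expLinearAct` — the shape of the (2.14) integrand at fixed fluctuation field and
parameters) are entire and dominated on the ball by `‖pre‖·e^{‖lin‖R₀}` (`expLinearMajorant`), so POTENTIAL-KP for them is
LITERALLY a Kotecký–Preiss condition on that majorant (`potentialKP_of_expLinear`) — the abstract form of «|exp[Σ
τ(Y)𝐕_k(Y,B)]| ≤ exp[Σ |τ(Y)||𝐕_k(Y,B)|]» with the radius (2.18).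
(§7, v1.1) The same step WITH THE FLUCTUATION INTEGRAL and the parameter integrals of (2.14): AVERAGED exp-linear activities
`Q ↦ ∫ pre(ω)·exp(ℓ_ω Q) dμ(ω)` over any measure space of parameters (integrable prefactor, strongly measurable functionals
with a uniform operator-norm bound `l` = the radii |τ(Y)| summed with the table weights) are complex differentiable on the ball
`‖Q‖ < R₀` — dominated differentiation under the integral sign, Mathlib's `hasFDerivAt_integral_of_dominated_of_fderiv_le` —
and dominated there by `∫ ‖pre‖·e^{l R₀} dμ` (`differentiableOn_integral_const_mul_cexp`, `norm_integral_const_mul_cexp_le`),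
so POTENTIAL-KP for them is a KP condition on THAT configuration-free majorant (`potentialKP_of_avgExpLinear`); a Dirac
parameter measure returns §6 (`avgExpLinearAct_dirac`).
(§8, v1.2) The GÂTEAUX form.  The engine uses holomorphy only along the pencil (one complex variable), so the binder is
weakened to LINE-HOLOMORPHY (`LineHolo`, `PotentialKPG` ⇐ `PotentialKP`), with the engine (`norm_clusterSum_sub_le_of_ballKPG`),
`outputLipschitz_of_potentialKPG`, `outerLipschitz_of_potentialKPG`, `ne9_and_fadingMemory_of_potentialKPG_perStep` re-derived
(same constants); and averaged exp-linear activities are line-holomorphic under SCALAR measurability of the functionals only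
(`differentiableOn_integral_const_mul_cexp_line`, `potentialKPG_of_avgExpLinear`: hypotheses `Integrable pre`, `∀ Q,
AEStronglyMeasurable (ω ↦ ℓ_ω Q)`, `‖ℓ_ω‖ ≤ l`, `0 ≤ R₀`, and the KP inequality for `∫ ‖pre‖·e^{l R₀} dμ`).  Reason recorded
in the §8 header: for a sup-normed space of tables that are functions of the fluctuation field, the evaluation functionals
`ω ↦ ℓ_ω` are not strongly measurable in operator norm under a diffuse fluctuation measure, so §7's `AEStronglyMeasurable lin μ`
could be unavailable in the intended instance; the scalar hypothesis always holds there.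
(§8e, v1.3) EVALUATION-TYPE FUNCTIONALS.  For the concrete table space `S →ᵇ ℂ` (bounded continuous functions on a
topological space `S` of field configurations) and functionals `T ↦ Σ_Y c_ω(Y)·T(pt_ω(Y))` (`evalFunctional`; finitely many
evaluations at measurable field-dependent points with measurable coefficients), `‖ℓ_ω‖ ≤ Σ_Y ‖c_ω(Y)‖`
(`norm_evalFunctional_le`) and `ω ↦ ℓ_ω(T)` is a.e.-strongly measurable for every table (`aestronglyMeasurable_evalFunctional_apply`),
so POTENTIAL-KPG for averaged exp-evaluation activities holds given only: integrable prefactors, `Σ_Y ‖c_ω(Y)‖ ≤ l`, `0 ≤ R₀`,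
and the displayed KP inequality for `∫ ‖pre‖·e^{l R₀} dμ` (`potentialKPG_of_avgEvalExpLinear`) — every analytic-regularity
hypothesis of the activity binder is discharged by construction on this table space; what stays displayed is G-ne9p2-5 (i).
WHAT IS STILL NOT PRINTED (GAPS G-ne9p2-5, moved not closed): POTENTIAL-KP for Bałaban's (2.14) activities as functions of
the potential TABLE on a ball of the (1.36)-weighted table space (print: for the one table 𝐕_k, via the parameters τ), the
pin budget constant `B₀` in the printed letters for differences, and the radius inequality of `fade_of_radius` (G-ne9p2-3).
Value = typed reduction one level closer to print + kernel bookkeeping; NOT summit progress.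
-/

noncomputable section

namespace Literature.MathematicalPhysics.QuantumFieldTheory.Balaban1983to89.T4HistoryLipschitzActivity

open scoped BigOperators
open Metric Set
open Literature.Probability.LatticeModels
open Literature.MathematicalPhysics.QuantumFieldTheory.Balaban1983to89.T4OutputRate
open Literature.MathematicalPhysics.QuantumFieldTheory.Balaban1983to89.T4ActivityLipschitz
open Literature.MathematicalPhysics.QuantumFieldTheory.Balaban1983to89.T4HistoryLipschitzRecursion
open Literature.MathematicalPhysics.QuantumFieldTheory.Balaban1983to89.T4HistoryLipschitzOuter

/-! ## §1 The geometry of a localized cluster representation and the binder POTENTIAL-KP -/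

/-- **CLUSTER GEOMETRY (HYPOTHESIS CARRIER, nothing asserted)**: the combinatorial part of the sibling's
`T4ActivityLipschitz.ClusterRep` — polymers `P` of all steps (Bałaban's localization domains `Z ∈ 𝐃_j`), the incompatibility
`ζ(Z, Z′) = 0` (reflexive, symmetric), the finite KP volume `vol X` of the step of a domain `X`, the finite families `clus X` of
polymers localizing at `X` (`∪_{Z∈K} Z = X`, (2.13)), and a pin of `X` touched by every localizing family.
[cite: Balaban1988RG2Cluster, (2.11)-(2.13) p.14] -/
structure ClusterGeom (C : Carriers) where
  /-- polymers (localization domains of all steps) -/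
  P : Type
  [decEq : DecidableEq P]
  /-- incompatibility `ζ(Z, Z′) = 0` -/
  inc : P → P → Prop
  [decRel : DecidableRel inc]
  inc_refl : ∀ γ, inc γ γ
  inc_symm : ∀ γ γ', inc γ γ' → inc γ' γ
  /-- the KP volume of the step of `X` -/
  vol : C.Dom → Finset P
  /-- the families of polymers localizing at `X` -/
  clus : C.Dom → Finset (Finset P)
  clus_sub : ∀ X, ∀ K ∈ clus X, K ⊆ vol X
  /-- a pin of `X` -/
  pin : C.Dom → P
  pin_mem : ∀ X, pin X ∈ vol X
  clus_pin : ∀ X, ∀ K ∈ clus X, KPTouches inc K (pin X)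

namespace ClusterGeom

variable {C : Carriers} (G : ClusterGeom C)

/-- Decidable equality of the polymers (field `decEq`). [folklore] -/
instance instDecEq : DecidableEq G.P := G.decEq

/-- Decidability of the incompatibility (field `decRel`). [folklore] -/
instance instDecRel : DecidableRel G.inc := G.decRel

/-- The incompatibility is reflexive (field `inc_refl`). [folklore] -/
instance instRefl : Std.Refl G.inc := ⟨G.inc_refl⟩

/-- The incompatibility is symmetric (field `inc_symm`). [folklore] -/
instance instSymm : Std.Symm G.inc := ⟨G.inc_symm⟩

/-- The geometry underlying a two-run cluster representation of the sibling leaf (same fields). [folklore] -/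
def ofRep (R : ClusterRep C) : ClusterGeom C where
  P := R.P
  decEq := R.decEq
  inc := R.inc
  decRel := R.decRel
  inc_refl := R.inc_refl
  inc_symm := R.inc_symm
  vol := R.vol
  clus := R.clus
  clus_sub := R.clus_sub
  pin := R.pin
  pin_mem := R.pin_mem
  clus_pin := R.clus_pin

variable {Bg : Type} {Pot : Type*}

/-- The NEW TERM at the potential configuration `Q` (complex; its real part is the functional): the localized cluster sum
`Σ_{K ∈ clus X} Φ^T(K; act k s U Q)` of the step-k activities at last coupling `s`, background `U`, potentials `Q` — the
shape of (2.13) p. 14 of [II] with the old terms made an explicit argument. [cite: Balaban1988RG2Cluster, (2.13) p.14] -/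
def newTerm (act : ℕ → ℝ → Bg → Pot → G.P → ℂ) (k : ℕ) (s : ℝ) (U : Bg) (X : C.Dom) (Q : Pot) : ℂ :=
  clusterSum G.inc (act k s U Q) (G.clus X)

/-- **POTENTIAL-KP (HYPOTHESIS SHAPE — printed TYPE for ONE potential table, NOT PRINTED uniformly on a ball of tables;
asserted nowhere)**: `a, d ≥ 0`, and on the window `W`, at every occurring last coupling `g k`, background `U` and
scale-(k+1) domain `X`: every activity of the step volume is complex differentiable in the potential configuration on the
ball `‖Q‖ < R₀`, dominated there by the `Q`-independent majorant `m k (g k) U`, which satisfies the `d`-weighted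
Kotecký–Preiss condition with size function `a` in the step volume.  Print (one table): (2.14)–(2.15) p. 15, (2.18) p. 16,
(2.26) p. 17, Lemma 3 (2.38) p. 20 of [II] (module docstring). [cite: Balaban1988RG2Cluster, (2.14)-(2.15) p.15 and Lemma 3 (2.38) p.20] -/
def PotentialKP [NormedAddCommGroup Pot] [NormedSpace ℂ Pot] (W : Set (ℕ → ℝ)) (act : ℕ → ℝ → Bg → Pot → G.P → ℂ)
    (m : ℕ → ℝ → Bg → G.P → ℝ) (a d : G.P → ℝ) (R₀ : ℝ) : Prop :=
  (∀ γ, 0 ≤ a γ) ∧ (∀ γ, 0 ≤ d γ) ∧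
    ∀ g ∈ W, ∀ (k : ℕ) (U : Bg) (X : C.Dom), C.scale X = k + 1 →
      (∀ γ ∈ G.vol X, DifferentiableOn ℂ (fun Q => act k (g k) U Q γ) (ball (0 : Pot) R₀)) ∧
      (∀ Q ∈ ball (0 : Pot) R₀, ∀ γ ∈ G.vol X, ‖act k (g k) U Q γ‖ ≤ m k (g k) U γ) ∧
      (∀ γ ∈ G.vol X, ∑ γ' ∈ G.vol X with G.inc γ' γ, m k (g k) U γ' * Real.exp (a γ' + d γ') ≤ a γ)

/-- **DECAY EXTRACTION (HYPOTHESIS SHAPE)**, as in the sibling leaf: a family localizing at `X` carries `d`-weight at least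
`δ X` (printed engine: (2.27) p. 18 «Σ_{Y∈𝐃}(d_k(Y) + 5) ≥ d_k(Y₀) + 5»). [cite: Balaban1988RG2Cluster, (2.27) p.18] -/
def DecayExtract (δ : C.Dom → ℝ) (d : G.P → ℝ) : Prop :=
  ∀ X, ∀ K ∈ G.clus X, δ X ≤ ∑ γ ∈ K, d γ

/-- **PIN BUDGET (HYPOTHESIS SHAPE)**, per creation step: on scale-(k+1) domains the KP size of the pin times the extracted
decay is within the envelope `B₀ k·e^{−κd(X)}` — the shape of the passage (2.40) → (2.41) p. 21 of [II], where a volume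
factor is absorbed by a unit of decay: «The last sum is bounded by C₃ε₁ exp 5κO(1)(LM)^{−4}|X| ≤ C₃ε₁ exp 5κO(1)
exp(LM)^{−4}|X|, and the last exponential multiplied by exp(−½δLκd_{k+1}(X)) is bounded by 1. This yields
|𝐄^{(k+1)}(X)| ≤ O(1)C₃ε₁ exp(−(1 − 10δ)½Lκd_{k+1}(X)). (2.41)».  The constant `B₀ k` for DIFFERENCES is not printed.
[cite: Balaban1988RG2Cluster, (2.40)-(2.41) p.21] -/
def PinBudget (a : G.P → ℝ) (δ : C.Dom → ℝ) (B₀ : ℕ → ℝ) (κ : ℝ) : Prop :=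
  ∀ (k : ℕ) (X : C.Dom), C.scale X = k + 1 → a (G.pin X) * Real.exp (-(δ X)) ≤ B₀ k * Real.exp (-(κ * C.d X))

end ClusterGeom

/-! ## §2 The Lipschitz bound of pinned cluster sums in a potential configuration ranging over a ball (kernel) -/

section PolymerGas

variable {P : Type*} [DecidableEq P] {inc : P → P → Prop} [DecidableRel inc]
variable {Pot : Type*} [NormedAddCommGroup Pot] [NormedSpace ℂ Pot]

omit [NormedSpace ℂ Pot] in
/-- A ball about a point of norm `≤ s₀` with radius the margin `R₀ − s₀` lies in the ball of radius `R₀` about the origin.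
[folklore] -/
theorem ball_subset_ball_origin {Q' : Pot} {s₀ R₀ : ℝ} (hQ' : ‖Q'‖ ≤ s₀) :
    ball Q' (R₀ - s₀) ⊆ ball (0 : Pot) R₀ := by
  intro p hp
  rw [mem_ball, dist_eq_norm] at hp
  rw [mem_ball_zero_iff]
  calc ‖p‖ = ‖p - Q' + Q'‖ := by rw [sub_add_cancel]
    _ ≤ ‖p - Q'‖ + ‖Q'‖ := norm_add_le _ _
    _ < R₀ - s₀ + s₀ := by linarith
    _ = R₀ := by ring

/-- **Pinned Lipschitz bound in the potentials, ball form** (the engine of this leaf).  Let `inc` be reflexive and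
symmetric, `a, d ≥ 0`, `s₀ < R₀`; let the activity family `Q ↦ w Q` be complex differentiable polymer-by-polymer on the ball
`‖Q‖ < R₀` of a complex normed space, dominated there by a `Q`-independent majorant `m` satisfying the `d`-weighted KP
condition with size `a` in the finite volume `L`; let every `K ∈ 𝒞` lie in `L`, touch the pin `γ ∈ L` and carry weight
`≥ δ`.  Then for `‖Q‖, ‖Q′‖ ≤ s₀`:
`‖E_{w Q}(𝒞) − E_{w Q′}(𝒞)‖ ≤ 4·a(γ)e^{−δ}/(R₀ − s₀)·‖Q − Q′‖`.
NEAR case by the pencil through `Q′`, `Q` and `norm_clusterSum_sub_le_of_family` on the disc of radius `(R₀ − s₀)/‖Q − Q′‖`;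
FAR case by twice `norm_clusterSum_le_of_kp`. [folklore] -/
theorem norm_clusterSum_sub_le_of_ballKP [Std.Refl inc] [Std.Symm inc] {w : Pot → P → ℂ} {m a d : P → ℝ}
    (ha : ∀ γ, 0 ≤ a γ) (hd : ∀ γ, 0 ≤ d γ) {L : Finset P} {s₀ R₀ : ℝ} (hsR : s₀ < R₀)
    (hhol : ∀ γ ∈ L, DifferentiableOn ℂ (fun Q => w Q γ) (ball (0 : Pot) R₀))
    (hmaj : ∀ Q ∈ ball (0 : Pot) R₀, ∀ γ ∈ L, ‖w Q γ‖ ≤ m γ)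
    (hkp : ∀ γ ∈ L, ∑ γ' ∈ L with inc γ' γ, m γ' * Real.exp (a γ' + d γ') ≤ a γ)
    {𝒞 : Finset (Finset P)} {γ : P} (hγ : γ ∈ L) (hsub : ∀ K ∈ 𝒞, K ⊆ L) (hpin : ∀ K ∈ 𝒞, KPTouches inc K γ)
    {δ : ℝ} (hdec : ∀ K ∈ 𝒞, δ ≤ ∑ γ' ∈ K, d γ') {Q Q' : Pot} (hQ : ‖Q‖ ≤ s₀) (hQ' : ‖Q'‖ ≤ s₀) :
    ‖clusterSum inc (w Q) 𝒞 - clusterSum inc (w Q') 𝒞‖ ≤ 4 * (a γ * Real.exp (-δ)) / (R₀ - s₀) * ‖Q - Q'‖ := by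
  have hϱ : 0 < R₀ - s₀ := sub_pos.mpr hsR
  have hball : ball Q' (R₀ - s₀) ⊆ ball (0 : Pot) R₀ := ball_subset_ball_origin hQ'
  have hQb : Q ∈ ball (0 : Pot) R₀ := mem_ball_zero_iff.2 (lt_of_le_of_lt hQ hsR)
  have hQ'b : Q' ∈ ball (0 : Pot) R₀ := mem_ball_zero_iff.2 (lt_of_le_of_lt hQ' hsR)
  have hKPpt : ∀ p ∈ ball (0 : Pot) R₀, ∀ γ ∈ L,
      ∑ γ' ∈ L with inc γ' γ, ‖w p γ'‖ * Real.exp (a γ' + d γ') ≤ a γ :=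
    fun p hp => kpd_of_norm_le (fun γ hγ => hmaj p hp γ hγ) hkp
  have hsize : ∀ p ∈ ball (0 : Pot) R₀, ‖clusterSum inc (w p) 𝒞‖ ≤ a γ * Real.exp (-δ) :=
    fun p hp => norm_clusterSum_le_of_kp ha hd (hKPpt p hp) hγ hsub hpin hdec
  have henv : 0 ≤ a γ * Real.exp (-δ) := mul_nonneg (ha γ) (Real.exp_nonneg _)
  rcases le_or_gt ‖Q - Q'‖ ((R₀ - s₀) / 2) with hnear | hfar
  · rcases (norm_nonneg (Q - Q')).eq_or_lt with h0 | hr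
    · have hQQ : Q = Q' := sub_eq_zero.1 (norm_eq_zero.1 h0.symm)
      rw [hQQ, sub_self, norm_zero, sub_self, norm_zero, mul_zero]
    · have hRz1 : 1 < (R₀ - s₀) / ‖Q - Q'‖ := by
        rw [one_lt_div hr]; linarith
      have hfit : (R₀ - s₀) / ‖Q - Q'‖ * ‖Q - Q'‖ ≤ R₀ - s₀ := (div_mul_cancel₀ _ hr.ne').le
      have hw : ∀ γ' ∈ L, DifferentiableOn ℂ (fun z : ℂ => w (inputPencil Q Q' z) γ')
          (ball (0 : ℂ) ((R₀ - s₀) / ‖Q - Q'‖)) :=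
        fun γ' hγ' => differentiableOn_comp_inputPencil (Ψ := fun p => w p γ') hϱ hfit ((hhol γ' hγ').mono hball)
      have hKPz : ∀ z : ℂ, ‖z‖ < (R₀ - s₀) / ‖Q - Q'‖ → ∀ γ ∈ L,
          ∑ γ' ∈ L with inc γ' γ, ‖w (inputPencil Q Q' z) γ'‖ * Real.exp (a γ' + d γ') ≤ a γ :=
        fun z hz => hKPpt _ (hball (inputPencil_mem_ball hϱ hfit hz))
      have key := norm_clusterSum_sub_le_of_family (inc := inc) (w := fun z => w (inputPencil Q Q' z)) ha hd hRz1
        hw hKPz hγ hsub hpin hdec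
      simp only [inputPencil_one, inputPencil_zero] at key
      have hden : 0 < R₀ - s₀ - ‖Q - Q'‖ := by linarith
      have hϱr : (R₀ - s₀ - ‖Q - Q'‖) / ‖Q - Q'‖ = (R₀ - s₀) / ‖Q - Q'‖ - 1 := by
        rw [sub_div, div_self hr.ne']
      calc ‖clusterSum inc (w Q) 𝒞 - clusterSum inc (w Q') 𝒞‖
          ≤ a γ / ((R₀ - s₀) / ‖Q - Q'‖ - 1) * Real.exp (-δ) := key
        _ = a γ * Real.exp (-δ) * ‖Q - Q'‖ / (R₀ - s₀ - ‖Q - Q'‖) := by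
            rw [← hϱr, div_div_eq_mul_div]; ring
        _ ≤ a γ * Real.exp (-δ) * ‖Q - Q'‖ / ((R₀ - s₀) / 2) :=
            div_le_div_of_nonneg_left (mul_nonneg henv (norm_nonneg _)) (by linarith) (by linarith)
        _ = 2 * (a γ * Real.exp (-δ)) / (R₀ - s₀) * ‖Q - Q'‖ := by
            rw [div_div_eq_mul_div]; ring
        _ ≤ 4 * (a γ * Real.exp (-δ)) / (R₀ - s₀) * ‖Q - Q'‖ :=
            mul_le_mul_of_nonneg_right (div_le_div_of_nonneg_right (by linarith) hϱ.le) (norm_nonneg _)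
  · calc ‖clusterSum inc (w Q) 𝒞 - clusterSum inc (w Q') 𝒞‖
        ≤ ‖clusterSum inc (w Q) 𝒞‖ + ‖clusterSum inc (w Q') 𝒞‖ := norm_sub_le _ _
      _ ≤ a γ * Real.exp (-δ) + a γ * Real.exp (-δ) := add_le_add (hsize Q hQb) (hsize Q' hQ'b)
      _ = a γ * Real.exp (-δ) * 2 := by ring
      _ ≤ a γ * Real.exp (-δ) * (4 * ‖Q - Q'‖ / (R₀ - s₀)) := by
          refine mul_le_mul_of_nonneg_left ?_ henv
          rw [le_div_iff₀ hϱ]; linarith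
      _ = 4 * (a γ * Real.exp (-δ)) / (R₀ - s₀) * ‖Q - Q'‖ := by ring

end PolymerGas

/-! ## §3 Over the carriers: the size bound and `OutputLipschitz` from POTENTIAL-KP -/

namespace ClusterGeom

variable {C : Carriers} (G : ClusterGeom C) {Bg : Type} {Pot : Type*} [NormedAddCommGroup Pot] [NormedSpace ℂ Pot]

/-- **The decay bound of the new term on the ball** (the shape of (2.41) p. 21; kernel): POTENTIAL-KP ∧ DECAY ∧ PIN BUDGET ⇒
`‖new term at Q‖ ≤ B₀ k·e^{−κd(X)}` for every `Q` of the ball — in particular the hypothesis `hB` of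
`T4HistoryLipschitzOuter.outputLipschitz_of_analyticOn_ball`. [folklore] -/
theorem norm_newTerm_le_of_potentialKP {W : Set (ℕ → ℝ)} {act : ℕ → ℝ → Bg → Pot → G.P → ℂ}
    {m : ℕ → ℝ → Bg → G.P → ℝ} {a d : G.P → ℝ} {δ : C.Dom → ℝ} {B₀ : ℕ → ℝ} {κ R₀ : ℝ}
    (hKP : G.PotentialKP W act m a d R₀) (hdec : G.DecayExtract δ d) (hpin : G.PinBudget a δ B₀ κ)
    {g : ℕ → ℝ} (hg : g ∈ W) {k : ℕ} {U : Bg} {X : C.Dom} (hX : C.scale X = k + 1) {Q : Pot}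
    (hQ : Q ∈ ball (0 : Pot) R₀) : ‖G.newTerm act k (g k) U X Q‖ ≤ B₀ k * Real.exp (-(κ * C.d X)) := by
  obtain ⟨ha, hd, hP⟩ := hKP
  obtain ⟨-, hmaj, hkp⟩ := hP g hg k U X hX
  exact (norm_clusterSum_le_of_kp ha hd (kpd_of_norm_le (fun γ hγ => hmaj Q hQ γ hγ) hkp) (G.pin_mem X)
    (G.clus_sub X) (G.clus_pin X) (hdec X)).trans (hpin k X hX)

/-- **`OutputLipschitz` FROM POTENTIAL-KP** (the theorem of this leaf).  Data: a reading `ρ k` of output configurations into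
`Pot` whose distances are dominated by the weighted majorant (`‖ρ k P − ρ k P′‖ ≤ M` whenever `∀ y, |P y − P′ y| ≤ wt k y·M`;
for the intended weighted sup-norm table space this is the definition of the norm); the POTENTIAL-DEPENDENT PART of the new
term is the cluster sum (`Ψ k s P U X − Ψ k s P′ U X = Re (newTerm (ρ k P) − newTerm (ρ k P′))`, a potential-independent
additive part being free); every occurring configuration `ρ k (T k g′ (E g))`, g, g′ ∈ W, has norm `≤ s₀ < R₀` (printed TYPE:
the history-uniform size (1.36) p. 9 of [II]).  Then POTENTIAL-KP ∧ DECAY ∧ PIN BUDGET ⇒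
`OutputLipschitz E W T Ψ κ wt (fun k => 4·B₀ k/(R₀ − s₀))` — §2 with `L = vol X`, `𝒞 = clus X`, pin `pin X`. [folklore] -/
theorem outputLipschitz_of_potentialKP {ι : Type} {E : Functional C Bg} {W : Set (ℕ → ℝ)}
    {T : ℕ → (ℕ → ℝ) → (Bg → C.Dom → ℝ) → ι → ℝ} {Ψ : ℕ → ℝ → (ι → ℝ) → Bg → C.Dom → ℝ}
    {act : ℕ → ℝ → Bg → Pot → G.P → ℂ} {m : ℕ → ℝ → Bg → G.P → ℝ} {a d : G.P → ℝ} {δ : C.Dom → ℝ} {B₀ : ℕ → ℝ}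
    {κ s₀ R₀ : ℝ} {wt : ℕ → ι → ℝ} (ρ : ℕ → (ι → ℝ) → Pot) (hKP : G.PotentialKP W act m a d R₀)
    (hdec : G.DecayExtract δ d) (hpin : G.PinBudget a δ B₀ κ) (hsR : s₀ < R₀)
    (hρ : ∀ (k : ℕ) (P P' : ι → ℝ) (M : ℝ), (∀ y, |P y - P' y| ≤ wt k y * M) → ‖ρ k P - ρ k P'‖ ≤ M)
    (hΨ : ∀ (k : ℕ) (s : ℝ) (P P' : ι → ℝ) (U : Bg) (X : C.Dom),
      Ψ k s P U X - Ψ k s P' U X = (G.newTerm act k s U X (ρ k P) - G.newTerm act k s U X (ρ k P')).re)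
    (hocc : ∀ g ∈ W, ∀ g' ∈ W, ∀ k : ℕ, ‖ρ k (T k g' (E g))‖ ≤ s₀) :
    OutputLipschitz E W T Ψ κ wt (fun k => 4 * B₀ k / (R₀ - s₀)) := by
  obtain ⟨ha, hd, hP⟩ := hKP
  intro g hg g' hg' k M hM U X hX
  obtain ⟨hhol, hmaj, hkp⟩ := hP g' hg' k U X hX
  have hQQ' : ‖ρ k (T k g' (E g)) - ρ k (T k g' (E g'))‖ ≤ M := hρ k _ _ M hM
  have hϱ : 0 < R₀ - s₀ := sub_pos.mpr hsR
  have key := norm_clusterSum_sub_le_of_ballKP (inc := G.inc) (w := fun Q => act k (g' k) U Q) ha hd hsR hhol hmaj hkp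
    (G.pin_mem X) (G.clus_sub X) (G.clus_pin X) (hdec X) (hocc g hg g' hg' k) (hocc g' hg' g' hg' k)
  have henv : 0 ≤ B₀ k * Real.exp (-(κ * C.d X)) :=
    le_trans (mul_nonneg (ha _) (Real.exp_nonneg _)) (hpin k X hX)
  rw [hΨ, Complex.sub_re]
  calc |(G.newTerm act k (g' k) U X (ρ k (T k g' (E g)))).re -
          (G.newTerm act k (g' k) U X (ρ k (T k g' (E g')))).re|
        = |(G.newTerm act k (g' k) U X (ρ k (T k g' (E g))) -
            G.newTerm act k (g' k) U X (ρ k (T k g' (E g')))).re| := by rw [Complex.sub_re]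
    _ ≤ ‖G.newTerm act k (g' k) U X (ρ k (T k g' (E g))) - G.newTerm act k (g' k) U X (ρ k (T k g' (E g')))‖ :=
        Complex.abs_re_le_norm _
    _ ≤ 4 * (a (G.pin X) * Real.exp (-(δ X))) / (R₀ - s₀) * ‖ρ k (T k g' (E g)) - ρ k (T k g' (E g'))‖ := key
    _ ≤ 4 * (B₀ k * Real.exp (-(κ * C.d X))) / (R₀ - s₀) * M := by
        have h4 : 0 ≤ 4 * (B₀ k * Real.exp (-(κ * C.d X))) / (R₀ - s₀) := by positivity
        exact mul_le_mul (div_le_div_of_nonneg_right (by linarith [hpin k X hX]) hϱ.le) hQQ' (norm_nonneg _) h4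
    _ = Real.exp (-(κ * C.d X)) * (4 * B₀ k / (R₀ - s₀) * M) := by ring

/-! ## §4 The composed binders: `OuterLipschitz`, NE9 ∧ FadingMemory from POTENTIAL-KP (by name) -/

/-- `OuterLipschitz E W T κ wt lam (fun k => 4·B₀ k/(R₀ − s₀))` from `Factorises`, `LastCouplingLipschitz` and the hypotheses
of `outputLipschitz_of_potentialKP` (`T4HistoryLipschitzOuter.outerLipschitz_of_factorisation`). [folklore] -/
theorem outerLipschitz_of_potentialKP {ι : Type} {E : Functional C Bg} {W : Set (ℕ → ℝ)}
    {T : ℕ → (ℕ → ℝ) → (Bg → C.Dom → ℝ) → ι → ℝ} {Ψ : ℕ → ℝ → (ι → ℝ) → Bg → C.Dom → ℝ}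
    {act : ℕ → ℝ → Bg → Pot → G.P → ℂ} {m : ℕ → ℝ → Bg → G.P → ℝ} {a d : G.P → ℝ} {δ : C.Dom → ℝ} {B₀ lam : ℕ → ℝ}
    {κ s₀ R₀ : ℝ} {wt : ℕ → ι → ℝ} (ρ : ℕ → (ι → ℝ) → Pot) (hfac : Factorises E W T Ψ)
    (hlast : LastCouplingLipschitz E W T Ψ κ lam) (hKP : G.PotentialKP W act m a d R₀) (hdec : G.DecayExtract δ d)
    (hpin : G.PinBudget a δ B₀ κ) (hsR : s₀ < R₀)
    (hρ : ∀ (k : ℕ) (P P' : ι → ℝ) (M : ℝ), (∀ y, |P y - P' y| ≤ wt k y * M) → ‖ρ k P - ρ k P'‖ ≤ M)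
    (hΨ : ∀ (k : ℕ) (s : ℝ) (P P' : ι → ℝ) (U : Bg) (X : C.Dom),
      Ψ k s P U X - Ψ k s P' U X = (G.newTerm act k s U X (ρ k P) - G.newTerm act k s U X (ρ k P')).re)
    (hocc : ∀ g ∈ W, ∀ g' ∈ W, ∀ k : ℕ, ‖ρ k (T k g' (E g))‖ ≤ s₀) :
    OuterLipschitz E W T κ wt lam (fun k => 4 * B₀ k / (R₀ - s₀)) :=
  outerLipschitz_of_factorisation hfac hlast (G.outputLipschitz_of_potentialKP ρ hKP hdec hpin hsR hρ hΨ hocc)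

/-- **NE9 ∧ FADING MEMORY FROM POTENTIAL-KP, every conditional by name** (`T4HistoryLipschitzRecursion` §6 with `c̄ =
4B/(R₀ − s₀)`): `ScaleZeroFree` ∧ `AdmissibleTerms` ∧ `ChannelAdditive` ∧ `ChannelSize … wt τ` (τ k j ≤ τ̄ω^{k−j}) ∧
`Factorises` ∧ `LastCouplingLipschitz … lam` (lam ≤ ℓ) ∧ POTENTIAL-KP ∧ DECAY ∧ PIN BUDGET (constant `B`) ∧ reading /
cluster-sum / occurrence hypotheses ∧ `s₀ < R₀` ⇒ `NE9 E W κ Λ` with `Λ k i = ℓ·(ω + (4B/(R₀ − s₀))τ̄)^{k−1−i}` and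
`FadingMemory (ℓ/(ω + (4B/(R₀ − s₀))τ̄)) (ω + (4B/(R₀ − s₀))τ̄) Λ`; the memory genuinely fades (rate < 1) iff the radius
inequality `4Bτ̄ < (R₀ − s₀)(1 − ω)` of `T4HistoryLipschitzOuter.fade_of_radius` holds (NOT PRINTED, GAPS G-ne9p2-3).
Rung (B)+1 bookkeeping on a fixed finite torus; nothing about [I]–[III] asserted. [folklore] -/
theorem ne9_and_fadingMemory_of_potentialKP {ι : Type} {E : Functional C Bg} {W : Set (ℕ → ℝ)}
    {Adm : Set (Bg → C.Dom → ℝ)} {T : ℕ → (ℕ → ℝ) → (Bg → C.Dom → ℝ) → ι → ℝ}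
    {Ψ : ℕ → ℝ → (ι → ℝ) → Bg → C.Dom → ℝ} {act : ℕ → ℝ → Bg → Pot → G.P → ℂ} {m : ℕ → ℝ → Bg → G.P → ℝ}
    {a d : G.P → ℝ} {δ : C.Dom → ℝ} {κ s₀ R₀ B ℓ τbar ω : ℝ} {wt : ℕ → ι → ℝ} {τ : ℕ → ℕ → ℝ} {lam : ℕ → ℝ}
    (ρ : ℕ → (ι → ℝ) → Pot) (h0 : ScaleZeroFree E W) (hAdm : AdmissibleTerms E W Adm) (hadd : ChannelAdditive Adm T)
    (hsize : ChannelSize Adm T κ wt τ) (hfac : Factorises E W T Ψ) (hlast : LastCouplingLipschitz E W T Ψ κ lam)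
    (hKP : G.PotentialKP W act m a d R₀) (hdec : G.DecayExtract δ d) (hpin : G.PinBudget a δ (fun _ => B) κ)
    (hsR : s₀ < R₀)
    (hρ : ∀ (k : ℕ) (P P' : ι → ℝ) (M : ℝ), (∀ y, |P y - P' y| ≤ wt k y * M) → ‖ρ k P - ρ k P'‖ ≤ M)
    (hΨ : ∀ (k : ℕ) (s : ℝ) (P P' : ι → ℝ) (U : Bg) (X : C.Dom),
      Ψ k s P U X - Ψ k s P' U X = (G.newTerm act k s U X (ρ k P) - G.newTerm act k s U X (ρ k P')).re)
    (hocc : ∀ g ∈ W, ∀ g' ∈ W, ∀ k : ℕ, ‖ρ k (T k g' (E g))‖ ≤ s₀) (hℓ : 0 ≤ ℓ) (hB : 0 ≤ B) (hτbar : 0 ≤ τbar)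
    (hω : 0 ≤ ω) (hpos : 0 < ω + 4 * B / (R₀ - s₀) * τbar) (hlam : ∀ k, lam k ≤ ℓ)
    (hτ : ∀ k j, j ≤ k → 0 ≤ τ k j ∧ τ k j ≤ τbar * ω ^ (k - j)) :
    NE9 E W κ (prodModuli ℓ fun _ => ω + 4 * B / (R₀ - s₀) * τbar) ∧
      FadingMemory (ℓ / (ω + 4 * B / (R₀ - s₀) * τbar)) (ω + 4 * B / (R₀ - s₀) * τbar)
        (prodModuli ℓ fun _ => ω + 4 * B / (R₀ - s₀) * τbar) :=
  have hc : 0 ≤ 4 * B / (R₀ - s₀) := div_nonneg (mul_nonneg (by norm_num) hB) (sub_pos.mpr hsR).le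
  ne9_and_fadingMemory_of_linearChannel h0 hAdm hadd hsize
    (G.outerLipschitz_of_potentialKP ρ hfac hlast hKP hdec hpin hsR hρ hΨ hocc) hℓ hc hτbar hω hpos hlam
    (fun _ => ⟨hc, le_rfl⟩) hτ

/-- **The same with the PER-CREATION-STEP, SIGN-GUARDED channel binders of `T4HistoryLipschitzRecursion` §8 (v1.3)** —
the most reduced hypothesis list of the lineage: `ScaleZeroFree` ∧ `AdmissibleTerms` ∧ `AdmRestrict` ∧ `ChannelAdditive` ∧
`ChannelStepSum` ∧ `ChannelSizeAtStepNN … wt τ` (printed TYPE: the (1.36) size bound PER CREATION STEP with the factor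
`L^{−(k−j)}`, pp. 7–9 of [II]; binder) ∧ `Factorises` ∧ `LastCouplingLipschitz` ∧ POTENTIAL-KP ∧ DECAY ∧ PIN BUDGET ∧ reading
/ cluster-sum / occurrence hypotheses ⇒ NE9 ∧ FadingMemory with the rate `ω + (4B/(R₀ − s₀))τ̄`
(`T4HistoryLipschitzRecursion.ne9_and_fadingMemory_of_perStepNN`). [folklore] -/
theorem ne9_and_fadingMemory_of_potentialKP_perStep {ι : Type} {E : Functional C Bg} {W : Set (ℕ → ℝ)}
    {Adm : Set (Bg → C.Dom → ℝ)} {T : ℕ → (ℕ → ℝ) → (Bg → C.Dom → ℝ) → ι → ℝ}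
    {Ψ : ℕ → ℝ → (ι → ℝ) → Bg → C.Dom → ℝ} {act : ℕ → ℝ → Bg → Pot → G.P → ℂ} {m : ℕ → ℝ → Bg → G.P → ℝ}
    {a d : G.P → ℝ} {δ : C.Dom → ℝ} {κ s₀ R₀ B ℓ τbar ω : ℝ} {wt : ℕ → ι → ℝ} {τ : ℕ → ℕ → ℝ} {lam : ℕ → ℝ}
    (ρ : ℕ → (ι → ℝ) → Pot) (h0 : ScaleZeroFree E W) (hAdm : AdmissibleTerms E W Adm) (hres : AdmRestrict Adm)
    (hadd : ChannelAdditive Adm T) (hsum : ChannelStepSum Adm T) (hstep : ChannelSizeAtStepNN Adm T κ wt τ)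
    (hfac : Factorises E W T Ψ) (hlast : LastCouplingLipschitz E W T Ψ κ lam) (hKP : G.PotentialKP W act m a d R₀)
    (hdec : G.DecayExtract δ d) (hpin : G.PinBudget a δ (fun _ => B) κ) (hsR : s₀ < R₀)
    (hρ : ∀ (k : ℕ) (P P' : ι → ℝ) (M : ℝ), (∀ y, |P y - P' y| ≤ wt k y * M) → ‖ρ k P - ρ k P'‖ ≤ M)
    (hΨ : ∀ (k : ℕ) (s : ℝ) (P P' : ι → ℝ) (U : Bg) (X : C.Dom),
      Ψ k s P U X - Ψ k s P' U X = (G.newTerm act k s U X (ρ k P) - G.newTerm act k s U X (ρ k P')).re)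
    (hocc : ∀ g ∈ W, ∀ g' ∈ W, ∀ k : ℕ, ‖ρ k (T k g' (E g))‖ ≤ s₀) (hℓ : 0 ≤ ℓ) (hB : 0 ≤ B) (hτbar : 0 ≤ τbar)
    (hω : 0 ≤ ω) (hpos : 0 < ω + 4 * B / (R₀ - s₀) * τbar) (hlam : ∀ k, lam k ≤ ℓ)
    (hτ : ∀ k j, j ≤ k → 0 ≤ τ k j ∧ τ k j ≤ τbar * ω ^ (k - j)) :
    NE9 E W κ (prodModuli ℓ fun _ => ω + 4 * B / (R₀ - s₀) * τbar) ∧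
      FadingMemory (ℓ / (ω + 4 * B / (R₀ - s₀) * τbar)) (ω + 4 * B / (R₀ - s₀) * τbar)
        (prodModuli ℓ fun _ => ω + 4 * B / (R₀ - s₀) * τbar) :=
  have hc : 0 ≤ 4 * B / (R₀ - s₀) := div_nonneg (mul_nonneg (by norm_num) hB) (sub_pos.mpr hsR).le
  ne9_and_fadingMemory_of_perStepNN h0 hAdm hres hadd hsum hstep
    (G.outerLipschitz_of_potentialKP ρ hfac hlast hKP hdec hpin hsR hρ hΨ hocc) hℓ hc hτbar hω hpos hlam
    (fun _ => ⟨hc, le_rfl⟩) hτ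

end ClusterGeom

/-! ## §5 A toy instance: one polymer, the linear activity `μ·Q` — the new term is the one-polymer truncated weight of the
previous term, and the whole hypothesis set of §4 holds (non-vacuity on a nonlinear recursion) -/

/-- The one-polymer geometry over the toy carriers of `T4HistoryLipschitzRecursion` §5 (domains = creation steps, no decay
length): one polymer, incompatible with itself, one localizing family `{{∙}}`, pin `∙`. [folklore] -/
abbrev kpToyGeom : ClusterGeom toyCarriers where
  P := Unit
  inc := fun _ _ => True
  decRel := fun _ _ => instDecidableTrue
  inc_refl := fun _ => trivial
  inc_symm := fun _ _ _ => trivial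
  vol := fun _ => {()}
  clus := fun _ => {{()}}
  clus_sub := fun _ K hK => by
    rw [Finset.mem_singleton] at hK
    rw [hK]
  pin := fun _ => ()
  pin_mem := fun _ => Finset.mem_singleton_self _
  clus_pin := fun _ K hK => by
    rw [Finset.mem_singleton] at hK
    rw [hK]
    exact ⟨(), Finset.mem_singleton_self _, trivial⟩

/-- The toy step volume is the one polymer. [folklore] -/
@[simp] theorem kpToyGeom_vol (X : ℕ) : kpToyGeom.vol X = {()} := rfl

/-- The toy localizing family is `{{∙}}`. [folklore] -/
@[simp] theorem kpToyGeom_clus (X : ℕ) : kpToyGeom.clus X = {{()}} := rfl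

/-- The toy pin. [folklore] -/
@[simp] theorem kpToyGeom_pin (X : ℕ) : kpToyGeom.pin X = () := rfl

/-- The toy activities: LINEAR in the potential value `Q ∈ ℂ`, `act k s U Q ∙ = μ·Q` (no explicit coupling or background
dependence). [folklore] -/
def kpToyAct (μ : ℝ) : ℕ → ℝ → Unit → ℂ → Unit → ℂ := fun _ _ _ Q _ => (μ : ℂ) * Q

/-- The toy new term does not read the explicit coupling (definitional). [folklore] -/
theorem kpToy_newTerm_indep (μ : ℝ) (k : ℕ) (s s' : ℝ) (u : Unit) (X : ℕ) (Q : ℂ) :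
    kpToyGeom.newTerm (kpToyAct μ) k s u X Q = kpToyGeom.newTerm (kpToyAct μ) k s' u X Q := rfl

/-- The toy recursion `E_{k+1} = g_k + Re Φ^T({∙}; μ·E_k)`, `E_0 = 0` — the new term is the tree's one-polymer cluster sum
(the Kotecký–Preiss logarithm of `1 + μE_k`), NOT postulated. [folklore] -/
def kpToySeq (μ : ℝ) (g : ℕ → ℝ) : ℕ → ℝ
  | 0 => 0
  | k + 1 => g k + (kpToyGeom.newTerm (kpToyAct μ) k (g k) () (k + 1) ((kpToySeq μ g k : ℝ) : ℂ)).re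

/-- The toy recursion, one step. [folklore] -/
theorem kpToySeq_succ (μ : ℝ) (g : ℕ → ℝ) (k : ℕ) :
    kpToySeq μ g (k + 1) = g k + (kpToyGeom.newTerm (kpToyAct μ) k (g k) () (k + 1) ((kpToySeq μ g k : ℝ) : ℂ)).re :=
  rfl

/-- The toy functional on the toy carriers. [folklore] -/
def kpToyE (μ : ℝ) : Functional toyCarriers Unit := fun g _ n => kpToySeq μ g n

/-- The toy new-term map: explicit coupling enters additively, the channel output through the cluster sum. [folklore] -/
def kpToyΨ (μ : ℝ) : ℕ → ℝ → (Unit → ℝ) → Unit → ℕ → ℝ :=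
  fun k s P u X => s + (kpToyGeom.newTerm (kpToyAct μ) k s u X ((P () : ℝ) : ℂ)).re

/-- The toy reading of an output configuration into `Pot = ℂ`. [folklore] -/
def kpToyRead : ℕ → (Unit → ℝ) → ℂ := fun _ P => ((P () : ℝ) : ℂ)

/-- POTENTIAL-KP for the toy on ANY window: activities `μQ` holomorphic on the ball `‖Q‖ < 6`, majorant `6μ`, size
function `a ≡ 1`, weights `d ≡ 0`, KP condition `6μ·e ≤ 1`. [folklore] -/
theorem kpToy_potentialKP {μ : ℝ} (hμ : 0 ≤ μ) (hμ1 : 6 * μ * Real.exp 1 ≤ 1) (W : Set (ℕ → ℝ)) :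
    kpToyGeom.PotentialKP W (kpToyAct μ) (fun _ _ _ _ => 6 * μ) (fun _ => 1) (fun _ => 0) 6 := by
  refine ⟨fun _ => zero_le_one, fun _ => le_rfl, fun g _ k U X _ => ⟨?_, ?_, ?_⟩⟩
  · intro γ _
    show DifferentiableOn ℂ (fun Q : ℂ => (μ : ℂ) * Q) (ball (0 : ℂ) 6)
    exact (differentiable_id.const_mul (μ : ℂ)).differentiableOn
  · intro Q hQ γ _
    show ‖(μ : ℂ) * Q‖ ≤ 6 * μ
    rw [mem_ball_zero_iff] at hQ
    rw [norm_mul, Complex.norm_real, Real.norm_eq_abs, abs_of_nonneg hμ]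
    nlinarith [norm_nonneg Q]
  · intro γ _
    calc ∑ γ' ∈ kpToyGeom.vol X with kpToyGeom.inc γ' γ,
          (fun (_ : ℕ) (_ : ℝ) (_ : Unit) (_ : Unit) => 6 * μ) k (g k) U γ' *
            Real.exp ((fun _ : Unit => (1 : ℝ)) γ' + (fun _ : Unit => (0 : ℝ)) γ')
        ≤ ∑ γ' ∈ kpToyGeom.vol X, (fun (_ : ℕ) (_ : ℝ) (_ : Unit) (_ : Unit) => 6 * μ) k (g k) U γ' *
            Real.exp ((fun _ : Unit => (1 : ℝ)) γ' + (fun _ : Unit => (0 : ℝ)) γ') :=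
          Finset.sum_le_sum_of_subset_of_nonneg (Finset.filter_subset _ _) fun _ _ _ => by positivity
      _ = 6 * μ * Real.exp 1 := by
          rw [kpToyGeom_vol, Finset.sum_singleton]
          simp only [add_zero]
      _ ≤ (fun _ : Unit => (1 : ℝ)) γ := hμ1

/-- DECAY EXTRACTION for the toy (no decay: `δ ≡ 0`, `d ≡ 0`). [folklore] -/
theorem kpToy_decayExtract : kpToyGeom.DecayExtract (fun _ => 0) (fun _ => 0) := by
  intro X K _
  simp

/-- PIN BUDGET for the toy: `a(∙)·e^0 = 1 ≤ 1·e^{−0}` (`B₀ ≡ 1`, κ = 0). [folklore] -/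
theorem kpToy_pinBudget : kpToyGeom.PinBudget (fun _ => 1) (fun _ => 0) (fun _ => 1) 0 := by
  intro k X _
  simp

/-- The toy reading is dominated by the weighted majorant with `wt ≡ 1`. [folklore] -/
theorem kpToy_read : ∀ (k : ℕ) (P P' : Unit → ℝ) (M : ℝ),
    (∀ y, |P y - P' y| ≤ (fun (_ : ℕ) (_ : Unit) => (1 : ℝ)) k y * M) → ‖kpToyRead k P - kpToyRead k P'‖ ≤ M := by
  intro k P P' M h
  have h1 := h ()
  simp only [one_mul] at h1
  simp only [kpToyRead]
  rw [← Complex.ofReal_sub, Complex.norm_real, Real.norm_eq_abs]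
  exact h1

/-- The potential-dependent part of the toy new-term map is the cluster sum. [folklore] -/
theorem kpToy_psi_sub (μ : ℝ) : ∀ (k : ℕ) (s : ℝ) (P P' : Unit → ℝ) (u : Unit) (X : ℕ),
    kpToyΨ μ k s P u X - kpToyΨ μ k s P' u X =
      (kpToyGeom.newTerm (kpToyAct μ) k s u X (kpToyRead k P) -
        kpToyGeom.newTerm (kpToyAct μ) k s u X (kpToyRead k P')).re := by
  intro k s P P' u X
  simp only [kpToyΨ, kpToyRead, Complex.sub_re]
  ring

/-- THE OCCURRING SIZE, proved inductively from the KP decay bound itself: for `|g_i| ≤ ½` every toy term satisfies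
`|E_k| ≤ 3/2` (`½ + a(∙)e^0 = 3/2 < R₀ = 6`). [folklore] -/
theorem kpToySeq_abs_le {μ : ℝ} (hμ : 0 ≤ μ) (hμ1 : 6 * μ * Real.exp 1 ≤ 1) {g : ℕ → ℝ}
    (hg : ∀ i, |g i| ≤ 1 / 2) : ∀ k, |kpToySeq μ g k| ≤ 3 / 2
  | 0 => by norm_num [kpToySeq]
  | k + 1 => by
      have ih := kpToySeq_abs_le hμ hμ1 hg k
      have hQ : ((kpToySeq μ g k : ℝ) : ℂ) ∈ ball (0 : ℂ) 6 := by
        rw [mem_ball_zero_iff, Complex.norm_real, Real.norm_eq_abs]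
        linarith
      have hN := kpToyGeom.norm_newTerm_le_of_potentialKP (kpToy_potentialKP hμ hμ1 Set.univ) kpToy_decayExtract
        kpToy_pinBudget (Set.mem_univ g) (k := k) (U := ()) (X := k + 1) rfl hQ
      simp only [zero_mul, neg_zero, Real.exp_zero, mul_one] at hN
      rw [kpToySeq_succ]
      calc |g k + (kpToyGeom.newTerm (kpToyAct μ) k (g k) () (k + 1) ((kpToySeq μ g k : ℝ) : ℂ)).re|
          ≤ |g k| + |(kpToyGeom.newTerm (kpToyAct μ) k (g k) () (k + 1) ((kpToySeq μ g k : ℝ) : ℂ)).re| :=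
            abs_add_le _ _
        _ ≤ 1 / 2 + 1 := add_le_add (hg k) ((Complex.abs_re_le_norm _).trans hN)
        _ = 3 / 2 := by norm_num

/-- Occurring output configurations of the toy — hybrid ones included (the toy channel does not read the coupling) — have
norm `≤ 3/2` on windows with `|g_i| ≤ ½`. [folklore] -/
theorem kpToy_occ {μ : ℝ} (hμ : 0 ≤ μ) (hμ1 : 6 * μ * Real.exp 1 ≤ 1) {W : Set (ℕ → ℝ)}
    (hW : ∀ g ∈ W, ∀ i, |g i| ≤ 1 / 2) :
    ∀ g ∈ W, ∀ g' ∈ W, ∀ k : ℕ, ‖kpToyRead k (toyChannel k g' (kpToyE μ g))‖ ≤ 3 / 2 := by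
  intro g hg g' _ k
  simp only [kpToyRead, toyChannel, kpToyE, Complex.norm_real, Real.norm_eq_abs]
  exact kpToySeq_abs_le hμ hμ1 (hW g hg) k

/-- The toy terms vanish at scale 0 for every history. [folklore] -/
theorem kpToy_scaleZeroFree (μ : ℝ) (W : Set (ℕ → ℝ)) : ScaleZeroFree (C := toyCarriers) (kpToyE μ) W := by
  intro g _ g' _ u X hX
  change X = 0 at hX
  subst hX
  rfl

/-- The toy functional FACTORISES through the toy channel of `T4HistoryLipschitzRecursion` §6 (`T k s H ∙ = H ∙ k`) and the
toy new-term map (definitional). [folklore] -/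
theorem kpToy_factorises (μ : ℝ) (W : Set (ℕ → ℝ)) :
    Factorises (C := toyCarriers) (kpToyE μ) W toyChannel (kpToyΨ μ) := by
  intro g _ k u X hX
  change X = k + 1 at hX
  subst hX
  obtain ⟨⟩ := u
  rfl

/-- The explicit last-coupling modulus of the toy is `lam ≡ 1` (κ = 0). [folklore] -/
theorem kpToy_lastCoupling (μ : ℝ) (W : Set (ℕ → ℝ)) :
    LastCouplingLipschitz (C := toyCarriers) (kpToyE μ) W toyChannel (kpToyΨ μ) 0 (fun _ => 1) := by
  intro g _ g' _ k u X _
  rw [show kpToyΨ μ k (g k) (toyChannel k g (kpToyE μ g)) u X -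
      kpToyΨ μ k (g' k) (toyChannel k g' (kpToyE μ g)) u X = g k - g' k from by
    simp only [kpToyΨ, toyChannel, kpToy_newTerm_indep μ k (g k) (g' k)]; ring]
  simp

/-- **NON-VACUITY OF THE WHOLE §4 HYPOTHESIS SET ON A NONLINEAR RECURSION, WITH THE CONSTANTS COMPUTED**: for `0 ≤ μ`,
`6μe ≤ 1` and a window of histories with `|g_i| ≤ ½`, the toy satisfies POTENTIAL-KP (radius 6), `OutputLipschitz` with the
§3 constant `4·1/(6 − 3/2) = 8/9`, and §4 returns NE9 with moduli `(8/9)^{k−1−i}` and `FadingMemory (9/8) (8/9)` — the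
radius inequality of `fade_of_radius` reads `4·1·1 < (6 − 3/2)(1 − 0)`. [folklore] -/
theorem kpToy_ne9 {μ : ℝ} (hμ : 0 ≤ μ) (hμ1 : 6 * μ * Real.exp 1 ≤ 1) {W : Set (ℕ → ℝ)}
    (hW : ∀ g ∈ W, ∀ i, |g i| ≤ 1 / 2) :
    kpToyGeom.PotentialKP W (kpToyAct μ) (fun _ _ _ _ => 6 * μ) (fun _ => 1) (fun _ => 0) 6 ∧
      OutputLipschitz (C := toyCarriers) (kpToyE μ) W toyChannel (kpToyΨ μ) 0 (fun _ _ => 1)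
        (fun _ => 4 * 1 / (6 - 3 / 2)) ∧
      (NE9 (C := toyCarriers) (kpToyE μ) W 0 (prodModuli 1 fun _ => (8 : ℝ) / 9) ∧
        FadingMemory ((9 : ℝ) / 8) (8 / 9) (prodModuli 1 fun _ => (8 : ℝ) / 9)) := by
  have hK := kpToy_potentialKP hμ hμ1 W
  have hsR : (3 : ℝ) / 2 < 6 := by norm_num
  refine ⟨hK, kpToyGeom.outputLipschitz_of_potentialKP kpToyRead hK kpToy_decayExtract kpToy_pinBudget hsR kpToy_read
    (kpToy_psi_sub μ) (kpToy_occ hμ hμ1 hW), ?_⟩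
  have hτ : ∀ k j : ℕ, j ≤ k →
      0 ≤ (fun k j : ℕ => if j = k then (1 : ℝ) else 0) k j ∧
        (fun k j : ℕ => if j = k then (1 : ℝ) else 0) k j ≤ 1 * 0 ^ (k - j) := by
    intro k j _
    refine ⟨by positivity, ?_⟩
    show (if j = k then (1 : ℝ) else 0) ≤ 1 * 0 ^ (k - j)
    split_ifs with h
    · subst h; simp
    · positivity
  have h := kpToyGeom.ne9_and_fadingMemory_of_potentialKP kpToyRead (kpToy_scaleZeroFree μ W)
    (⟨fun _ _ => Set.mem_univ _, fun _ _ _ _ => Set.mem_univ _⟩ :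
      AdmissibleTerms (C := toyCarriers) (kpToyE μ) W Set.univ)
    (toy_linearChannel (μ := 0) le_rfl W).2.1 (toy_linearChannel (μ := 0) le_rfl W).2.2.1 (kpToy_factorises μ W)
    (kpToy_lastCoupling μ W) hK kpToy_decayExtract kpToy_pinBudget hsR kpToy_read (kpToy_psi_sub μ)
    (kpToy_occ hμ hμ1 hW) zero_le_one zero_le_one zero_le_one le_rfl (by norm_num) (fun _ => le_rfl) hτ
  have e1 : (0 : ℝ) + 4 * 1 / (6 - 3 / 2) * 1 = 8 / 9 := by norm_num
  have e2 : (1 : ℝ) / (8 / 9) = 9 / 8 := by norm_num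
  simp only [e1, e2] at h
  exact h

/-! ## §6 The (2.14) → (2.15) majorant step in kernel, integrand level: activities «prefactor × exp(linear functional of the
potential configuration)» (the shape of the (2.14) INTEGRAND at fixed fluctuation field and fixed interpolation / contour
parameters — DOCFIX v1.1; the averaged form is §7) are entire in the configuration and dominated on the ball `‖Q‖ < R₀` by
`‖prefactor‖·e^{‖functional‖·R₀}`, so POTENTIAL-KP for them IS a Kotecký–Preiss condition on that configuration-free majorant -/

section ExpLinear

variable {Pot : Type*} [NormedAddCommGroup Pot] [NormedSpace ℂ Pot]

/-- `Q ↦ c·exp(ℓ Q)` is entire for a continuous linear `ℓ`. [folklore] -/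
theorem differentiable_const_mul_cexp (c : ℂ) (ℓ : Pot →L[ℂ] ℂ) :
    Differentiable ℂ (fun Q : Pot => c * Complex.exp (ℓ Q)) :=
  (ℓ.differentiable.cexp).const_mul c

/-- The printed step (2.14) → (2.15) p. 15 of [II] («exp[Σ_{Y∈𝐃} τ(Y)𝐕_k(Y,B)]» bounded by «exp[Σ_{Y∈𝐃}
|τ(Y)||𝐕_k(Y,B)|]»), abstractly: on the ball `‖Q‖ < R₀`, `‖c·exp(ℓ Q)‖ ≤ ‖c‖·e^{‖ℓ‖R₀}`. [folklore] -/
theorem norm_const_mul_cexp_le {c : ℂ} {ℓ : Pot →L[ℂ] ℂ} {R₀ : ℝ} {Q : Pot} (hQ : Q ∈ ball (0 : Pot) R₀) :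
    ‖c * Complex.exp (ℓ Q)‖ ≤ ‖c‖ * Real.exp (‖ℓ‖ * R₀) := by
  rw [norm_mul, Complex.norm_exp]
  refine mul_le_mul_of_nonneg_left ?_ (norm_nonneg _)
  rw [Real.exp_le_exp]
  calc (ℓ Q).re ≤ |(ℓ Q).re| := le_abs_self _
    _ ≤ ‖ℓ Q‖ := Complex.abs_re_le_norm _
    _ ≤ ‖ℓ‖ * ‖Q‖ := ℓ.le_opNorm Q
    _ ≤ ‖ℓ‖ * R₀ := mul_le_mul_of_nonneg_left (mem_ball_zero_iff.1 hQ).le (norm_nonneg _)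

end ExpLinear

namespace ClusterGeom

variable {C : Carriers} (G : ClusterGeom C) {Bg : Type} {Pot : Type*} [NormedAddCommGroup Pot] [NormedSpace ℂ Pot]

/-- Activities of the shape of the (2.14) INTEGRAND in the potential configuration (DOCFIX v1.1: at FIXED fluctuation field
`B` and fixed interpolation / contour parameters `s, σ, t, τ`; the term (2.14) itself averages such integrands — §7): a
configuration-free prefactor (at fixed step, last coupling, background: the Gaussian densities, characteristic functions and
sign of (2.14), which do not read the old terms — THIS SEAT'S READING of p. 15) times the exponential of a continuous linear
functional of the configuration (the factor «exp[Σ_{Y∈𝐃} τ(Y)𝐕_k(Y,B)]» at fixed `B`, `τ`).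
[cite: Balaban1988RG2Cluster, (2.14) p.15] -/
def expLinearAct (pre : ℕ → ℝ → Bg → G.P → ℂ) (lin : ℕ → ℝ → Bg → G.P → (Pot →L[ℂ] ℂ)) :
    ℕ → ℝ → Bg → Pot → G.P → ℂ :=
  fun k s U Q γ => pre k s U γ * Complex.exp (lin k s U γ Q)

/-- The configuration-free majorant of `expLinearAct` on the ball of radius `R₀`: `‖pre‖·e^{‖lin‖R₀}` (the shape of
(2.15) with the radius (2.18) = inverse size of the potentials). [cite: Balaban1988RG2Cluster, (2.15) p.15 and (2.18) p.16] -/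
def expLinearMajorant (pre : ℕ → ℝ → Bg → G.P → ℂ) (lin : ℕ → ℝ → Bg → G.P → (Pot →L[ℂ] ℂ)) (R₀ : ℝ) :
    ℕ → ℝ → Bg → G.P → ℝ :=
  fun k s U γ => ‖pre k s U γ‖ * Real.exp (‖lin k s U γ‖ * R₀)

/-- **POTENTIAL-KP for (2.14)-shaped activities IS a KP condition on the configuration-free majorant** (kernel): holomorphy
and domination on the ball are automatic (§6 lemmas); what remains is the `d`-weighted Kotecký–Preiss inequality for
`‖pre‖·e^{‖lin‖R₀}` in every step volume — for Bałaban's letters the content of (2.26) → Lemma 3 (2.38) read with the radius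
(2.18), printed for the one table 𝐕_k (module docstring; the uniformity is the hypothesis displayed here). [folklore] -/
theorem potentialKP_of_expLinear {W : Set (ℕ → ℝ)} {pre : ℕ → ℝ → Bg → G.P → ℂ}
    {lin : ℕ → ℝ → Bg → G.P → (Pot →L[ℂ] ℂ)} {a d : G.P → ℝ} {R₀ : ℝ} (ha : ∀ γ, 0 ≤ a γ) (hd : ∀ γ, 0 ≤ d γ)
    (hkp : ∀ g ∈ W, ∀ (k : ℕ) (U : Bg) (X : C.Dom), C.scale X = k + 1 → ∀ γ ∈ G.vol X,
      ∑ γ' ∈ G.vol X with G.inc γ' γ, G.expLinearMajorant pre lin R₀ k (g k) U γ' * Real.exp (a γ' + d γ') ≤ a γ) :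
    G.PotentialKP W (G.expLinearAct pre lin) (G.expLinearMajorant pre lin R₀) a d R₀ := by
  refine ⟨ha, hd, fun g hg k U X hX => ⟨?_, ?_, hkp g hg k U X hX⟩⟩
  · intro γ _
    exact (differentiable_const_mul_cexp (pre k (g k) U γ) (lin k (g k) U γ)).differentiableOn
  · intro Q hQ γ _
    exact norm_const_mul_cexp_le hQ

end ClusterGeom

/-! ## §7 (v1.1) The (2.14) → (2.15) step WITH the fluctuation integral: AVERAGED exp-linear activities
`Q ↦ ∫ pre(ω)·exp(ℓ_ω Q) dμ(ω)` — `ω` ranging over a measure space of parameters (for (2.14) p. 15 of [II]: the fluctuation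
field `B` under the Gaussian measure, the interpolation parameters `s(Δ), t(Y) ∈ [0,1]`, the contour parameters `σ(Δ), τ(Y)`
on circles of radii (2.18), the density factors absorbed into the complex prefactor) — are complex differentiable on the ball
`‖Q‖ < R₀` by dominated differentiation under the integral sign, and dominated there by `∫ ‖pre‖·e^{l R₀} dμ` when the
functionals obey `‖ℓ_ω‖ ≤ l`; so POTENTIAL-KP for them is, again, a Kotecký–Preiss condition on a configuration-free
majorant.  [folklore] kernel bookkeeping; the identification with Bałaban's letters is the READING of the module docstring. -/

section Averaged

open MeasureTheory

variable {Pot : Type*} [NormedAddCommGroup Pot] [NormedSpace ℂ Pot]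
variable {Ω : Type*} [MeasurableSpace Ω]

/-- The integrand bound on the ball under a bound `l` on the functional: `‖c·exp(ℓ Q)‖ ≤ ‖c‖·e^{l R₀}`. [folklore] -/
theorem norm_const_mul_cexp_le_of_le {c : ℂ} {ℓ : Pot →L[ℂ] ℂ} {l R₀ : ℝ} {Q : Pot} (hl : ‖ℓ‖ ≤ l) (hR : 0 ≤ R₀)
    (hQ : Q ∈ ball (0 : Pot) R₀) : ‖c * Complex.exp (ℓ Q)‖ ≤ ‖c‖ * Real.exp (l * R₀) :=
  (norm_const_mul_cexp_le hQ).trans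
    (mul_le_mul_of_nonneg_left (Real.exp_le_exp.2 (mul_le_mul_of_nonneg_right hl hR)) (norm_nonneg _))

/-- The Fréchet derivative of the integrand `Q ↦ c·exp(ℓ Q)`: `(c·exp(ℓ Q)) • ℓ`. [folklore] -/
theorem hasFDerivAt_const_mul_cexp (c : ℂ) (ℓ : Pot →L[ℂ] ℂ) (Q : Pot) :
    HasFDerivAt (fun Q : Pot => c * Complex.exp (ℓ Q)) ((c * Complex.exp (ℓ Q)) • ℓ) Q := by
  have h1 : HasFDerivAt (fun Q : Pot => Complex.exp (ℓ Q)) (Complex.exp (ℓ Q) • ℓ) Q :=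
    (Complex.hasDerivAt_exp (ℓ Q)).comp_hasFDerivAt Q ℓ.hasFDerivAt
  have h2 := h1.const_mul c
  rw [smul_smul] at h2
  exact h2

/-- Measurability of the integrand in the parameter: an a.e.-strongly-measurable prefactor and an a.e.-strongly-measurable
family of functionals give an a.e.-strongly-measurable integrand at every configuration. [folklore] -/
theorem aestronglyMeasurable_const_mul_cexp {μ : Measure Ω} {pre : Ω → ℂ} {lin : Ω → (Pot →L[ℂ] ℂ)}
    (hpre : AEStronglyMeasurable pre μ) (hlin : AEStronglyMeasurable lin μ) (Q : Pot) :
    AEStronglyMeasurable (fun ω => pre ω * Complex.exp (lin ω Q)) μ := by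
  have h1 : AEStronglyMeasurable (fun ω => lin ω Q) μ :=
    (ContinuousLinearMap.apply ℂ ℂ Q).continuous.comp_aestronglyMeasurable hlin
  exact hpre.mul (Complex.continuous_exp.comp_aestronglyMeasurable h1)

/-- **The (2.15)-type majorant of an averaged exp-linear activity** (kernel): for an integrable prefactor and functionals of
operator norm `≤ l`, on the ball `‖Q‖ < R₀` one has `‖∫ pre(ω)·exp(ℓ_ω Q) dμ(ω)‖ ≤ ∫ ‖pre(ω)‖·e^{l R₀} dμ(ω)` — the
abstract form of the passage from (2.14) to (2.15) p. 15 of [II] (absolute values inside the fluctuation integral, «exp[Σ_{Y∈𝐃}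
|τ(Y)||𝐕_k(Y,B)|]» with |τ(Y)| the radius (2.18)). [folklore] -/
theorem norm_integral_const_mul_cexp_le {μ : Measure Ω} {pre : Ω → ℂ} {lin : Ω → (Pot →L[ℂ] ℂ)} {l R₀ : ℝ}
    (hpre : Integrable pre μ) (hl : ∀ ω, ‖lin ω‖ ≤ l) (hR : 0 ≤ R₀) {Q : Pot} (hQ : Q ∈ ball (0 : Pot) R₀) :
    ‖∫ ω, pre ω * Complex.exp (lin ω Q) ∂μ‖ ≤ ∫ ω, ‖pre ω‖ * Real.exp (l * R₀) ∂μ :=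
  norm_integral_le_of_norm_le (hpre.norm.mul_const _)
    (Filter.Eventually.of_forall fun ω => norm_const_mul_cexp_le_of_le (hl ω) hR hQ)

/-- **Holomorphy of an averaged exp-linear activity on the ball** (kernel; dominated differentiation under the integral sign,
`hasFDerivAt_integral_of_dominated_of_fderiv_le`): for an integrable prefactor and an a.e.-strongly-measurable family of
functionals of operator norm `≤ l`, `Q ↦ ∫ pre(ω)·exp(ℓ_ω Q) dμ(ω)` is complex differentiable on `‖Q‖ < R₀` (any `R₀`).
The dominating function on the ball `B(Q₀, R₀ − ‖Q₀‖)` is `‖pre(ω)‖·e^{l R₀}·l`. [folklore] -/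
theorem differentiableOn_integral_const_mul_cexp {μ : Measure Ω} {pre : Ω → ℂ} {lin : Ω → (Pot →L[ℂ] ℂ)} {l : ℝ}
    (hpre : Integrable pre μ) (hlin : AEStronglyMeasurable lin μ) (hl : ∀ ω, ‖lin ω‖ ≤ l) (R₀ : ℝ) :
    DifferentiableOn ℂ (fun Q : Pot => ∫ ω, pre ω * Complex.exp (lin ω Q) ∂μ) (ball (0 : Pot) R₀) := by
  intro Q₀ hQ₀
  have hR : ‖Q₀‖ < R₀ := mem_ball_zero_iff.1 hQ₀
  have hR0 : 0 ≤ R₀ := (norm_nonneg _).trans hR.le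
  have hεpos : 0 < R₀ - ‖Q₀‖ := sub_pos.2 hR
  have hsub : ∀ Q ∈ ball Q₀ (R₀ - ‖Q₀‖), Q ∈ ball (0 : Pot) R₀ := by
    intro Q hQ
    rw [mem_ball_zero_iff]
    have hQ' : ‖Q - Q₀‖ < R₀ - ‖Q₀‖ := mem_ball_iff_norm.1 hQ
    calc ‖Q‖ = ‖(Q - Q₀) + Q₀‖ := by rw [sub_add_cancel]
      _ ≤ ‖Q - Q₀‖ + ‖Q₀‖ := norm_add_le _ _
      _ < R₀ := by linarith
  have hmeas : ∀ Q, AEStronglyMeasurable (fun ω => pre ω * Complex.exp (lin ω Q)) μ := fun Q =>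
    aestronglyMeasurable_const_mul_cexp hpre.aestronglyMeasurable hlin Q
  have key : HasFDerivAt (fun Q : Pot => ∫ ω, pre ω * Complex.exp (lin ω Q) ∂μ)
      (∫ ω, (pre ω * Complex.exp (lin ω Q₀)) • lin ω ∂μ) Q₀ := by
    refine hasFDerivAt_integral_of_dominated_of_fderiv_le
      (F' := fun Q ω => (pre ω * Complex.exp (lin ω Q)) • lin ω)
      (bound := fun ω => ‖pre ω‖ * Real.exp (l * R₀) * l) (ball_mem_nhds Q₀ hεpos) ?_ ?_ ?_ ?_ ?_ ?_
    · exact Filter.Eventually.of_forall hmeas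
    · exact Integrable.mono' (hpre.norm.mul_const (Real.exp (l * R₀))) (hmeas Q₀)
        (Filter.Eventually.of_forall fun ω => norm_const_mul_cexp_le_of_le (hl ω) hR0 hQ₀)
    · exact (hmeas Q₀).smul hlin
    · refine Filter.Eventually.of_forall fun ω Q hQ => ?_
      rw [norm_smul]
      exact mul_le_mul (norm_const_mul_cexp_le_of_le (hl ω) hR0 (hsub Q hQ)) (hl ω) (norm_nonneg _)
        (mul_nonneg (norm_nonneg _) (Real.exp_pos _).le)
    · exact (hpre.norm.mul_const _).mul_const _
    · exact Filter.Eventually.of_forall fun ω Q _ => hasFDerivAt_const_mul_cexp (pre ω) (lin ω) Q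
  exact key.differentiableAt.differentiableWithinAt

end Averaged

namespace ClusterGeom

open MeasureTheory

variable {C : Carriers} (G : ClusterGeom C) {Bg : Type} {Pot : Type*} [NormedAddCommGroup Pot] [NormedSpace ℂ Pot]
variable {Ω : Type*} [MeasurableSpace Ω]

/-- AVERAGED exp-linear activities — the shape of a whole term of (2.14) p. 15 of [II] in the potential configuration (THIS
SEAT'S READING, module docstring): at step `k`, last coupling `s`, background `U`, for the polymer `γ`, the average over a
parameter `ω` (fluctuation field and interpolation / contour parameters, measure `μ k s U γ`) of «prefactor(ω) × exp(linear
functional_ω of the configuration)».  [cite: Balaban1988RG2Cluster, (2.14) p.15] -/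
def avgExpLinearAct (μ : ℕ → ℝ → Bg → G.P → Measure Ω) (pre : ℕ → ℝ → Bg → G.P → Ω → ℂ)
    (lin : ℕ → ℝ → Bg → G.P → Ω → (Pot →L[ℂ] ℂ)) : ℕ → ℝ → Bg → Pot → G.P → ℂ :=
  fun k s U Q γ => ∫ ω, pre k s U γ ω * Complex.exp (lin k s U γ ω Q) ∂(μ k s U γ)

/-- Its configuration-free majorant on the ball of radius `R₀` under the operator-norm bounds `l k s U γ` of the functionals:
`∫ ‖pre‖·e^{l R₀} dμ` (the shape of (2.15)/(2.26) with |τ(Y)| the radius (2.18)).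
[cite: Balaban1988RG2Cluster, (2.15) p.15, (2.18) p.16, (2.26) p.17] -/
def avgExpLinearMajorant (μ : ℕ → ℝ → Bg → G.P → Measure Ω) (pre : ℕ → ℝ → Bg → G.P → Ω → ℂ)
    (l : ℕ → ℝ → Bg → G.P → ℝ) (R₀ : ℝ) : ℕ → ℝ → Bg → G.P → ℝ :=
  fun k s U γ => ∫ ω, ‖pre k s U γ ω‖ * Real.exp (l k s U γ * R₀) ∂(μ k s U γ)

/-- Consistency with §6: a Dirac parameter measure gives back the exp-linear activity. [folklore] -/
theorem avgExpLinearAct_dirac [MeasurableSingletonClass Ω] (ω₀ : Ω) (pre : ℕ → ℝ → Bg → G.P → Ω → ℂ)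
    (lin : ℕ → ℝ → Bg → G.P → Ω → (Pot →L[ℂ] ℂ)) :
    G.avgExpLinearAct (fun _ _ _ _ => Measure.dirac ω₀) pre lin =
      G.expLinearAct (fun k s U γ => pre k s U γ ω₀) (fun k s U γ => lin k s U γ ω₀) := by
  funext k s U Q γ
  simp only [avgExpLinearAct, expLinearAct]
  exact integral_dirac _ _

/-- **POTENTIAL-KP for averaged exp-linear activities IS a KP condition on the configuration-free majorant** (kernel): with
integrable prefactors, a.e.-strongly-measurable functionals of operator norm `≤ l`, and `0 ≤ R₀`, holomorphy on the ball
(`differentiableOn_integral_const_mul_cexp`) and domination (`norm_integral_const_mul_cexp_le`) are automatic; what remains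
is the `d`-weighted Kotecký–Preiss inequality for `∫ ‖pre‖·e^{l R₀} dμ` in every step volume at the occurring couplings —
for Bałaban's letters the content of (2.15) → (2.26) → Lemma 3 (2.38) read with the radii (2.18), printed for the one table
𝐕_k; the uniformity over tables of the same size is the hypothesis displayed (GAPS G-ne9p2-5). [folklore] -/
theorem potentialKP_of_avgExpLinear {W : Set (ℕ → ℝ)} {μ : ℕ → ℝ → Bg → G.P → Measure Ω}
    {pre : ℕ → ℝ → Bg → G.P → Ω → ℂ} {lin : ℕ → ℝ → Bg → G.P → Ω → (Pot →L[ℂ] ℂ)} {l : ℕ → ℝ → Bg → G.P → ℝ}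
    {a d : G.P → ℝ} {R₀ : ℝ} (ha : ∀ γ, 0 ≤ a γ) (hd : ∀ γ, 0 ≤ d γ) (hR : 0 ≤ R₀)
    (hpre : ∀ k s U γ, Integrable (pre k s U γ) (μ k s U γ))
    (hlin : ∀ k s U γ, AEStronglyMeasurable (lin k s U γ) (μ k s U γ))
    (hl : ∀ k s U γ ω, ‖lin k s U γ ω‖ ≤ l k s U γ)
    (hkp : ∀ g ∈ W, ∀ (k : ℕ) (U : Bg) (X : C.Dom), C.scale X = k + 1 → ∀ γ ∈ G.vol X,
      ∑ γ' ∈ G.vol X with G.inc γ' γ, G.avgExpLinearMajorant μ pre l R₀ k (g k) U γ' * Real.exp (a γ' + d γ') ≤ a γ) :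
    G.PotentialKP W (G.avgExpLinearAct μ pre lin) (G.avgExpLinearMajorant μ pre l R₀) a d R₀ := by
  refine ⟨ha, hd, fun g hg k U X hX => ⟨?_, ?_, hkp g hg k U X hX⟩⟩
  · intro γ _
    exact differentiableOn_integral_const_mul_cexp (hpre k (g k) U γ) (hlin k (g k) U γ) (hl k (g k) U γ) R₀
  · intro Q hQ γ _
    exact norm_integral_const_mul_cexp_le (hpre k (g k) U γ) (hl k (g k) U γ) hR hQ

end ClusterGeom

/-! ## §8 (v1.2) The GÂTEAUX form: line-holomorphy suffices, and averaged activities need only WEAK measurability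
The engine of §2 uses holomorphy of the activities only ALONG THE PENCIL through the two occurring configurations — one
complex variable.  §8 records the correspondingly weaker binder POTENTIAL-KPG (`PotentialKPG`: holomorphy along every
complex line inside the ball, `LineHolo`, instead of Fréchet holomorphy on the ball), re-derives the engine and
`OutputLipschitz` / `OuterLipschitz` / NE9 ∧ FadingMemory from it (§8a–§8c; the proofs are those of §2–§4 with the one
pencil line changed), and proves POTENTIAL-KPG for the averaged exp-linear activities of §7 under SCALAR measurability of the
functionals `ω ↦ ℓ_ω(Q)` only (§8d).  WHY (recorded for the instantiating seat): in the intended reading of (2.14) the table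
space is a space of functions of the fluctuation field and `ℓ_ω` is a finite combination of EVALUATIONS at the field `B_ω`;
for a sup-normed table space and a diffuse (Gaussian) fluctuation measure the map `ω ↦ ℓ_ω` is then NOT a.e.-strongly
measurable in the operator-norm topology (distinct evaluations are at distance 2), so the hypothesis `AEStronglyMeasurable
lin μ` of §7 would be unavailable there (it is available when the tables are analytic in the field with a margin, by Cauchy
estimates — cf. p. 15 of [II] «analytic on the space 𝐔^c_{k+1}(Y,(1+β)α₀,(1+β)α₁,α₀)»); the Gâteaux form asks only that
each scalar function `ω ↦ ℓ_ω(Q)` be measurable, which evaluation functionals always satisfy.  [folklore] -/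

section Gateaux

variable {Pot : Type*} [NormedAddCommGroup Pot] [NormedSpace ℂ Pot]

/-- LINE-HOLOMORPHY on the ball of radius `R₀` (Gâteaux holomorphy): along every complex line `z ↦ Q₀ + z•V`, `w` is complex
differentiable wherever the line runs inside the ball `‖·‖ < R₀`. [folklore] -/
def LineHolo (w : Pot → ℂ) (R₀ : ℝ) : Prop :=
  ∀ Q₀ V : Pot, DifferentiableOn ℂ (fun z : ℂ => w (Q₀ + z • V)) {z : ℂ | Q₀ + z • V ∈ ball (0 : Pot) R₀}

/-- Fréchet holomorphy on the ball implies line-holomorphy. [folklore] -/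
theorem lineHolo_of_differentiableOn {w : Pot → ℂ} {R₀ : ℝ} (hw : DifferentiableOn ℂ w (ball (0 : Pot) R₀)) :
    LineHolo w R₀ := fun Q₀ V =>
  hw.comp ((differentiable_const Q₀).add (differentiable_id.smul_const V)).differentiableOn fun _ hz => hz

variable {P : Type*} [DecidableEq P] {inc : P → P → Prop} [DecidableRel inc]

/-- **Pinned Lipschitz bound in the potentials, ball form, GÂTEAUX hypotheses** — `norm_clusterSum_sub_le_of_ballKP` with
Fréchet holomorphy on the ball replaced by line-holomorphy (`LineHolo`); same constant `4·a(γ)e^{−δ}/(R₀ − s₀)`.  The proof is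
§2's: the pencil `inputPencil Q Q′ z = Q′ + z•(Q − Q′)` is a complex line, and the disc `‖z‖ < (R₀ − s₀)/‖Q − Q′‖` lies in
the set where it runs inside the ball. [folklore] -/
theorem norm_clusterSum_sub_le_of_ballKPG [Std.Refl inc] [Std.Symm inc] {w : Pot → P → ℂ} {m a d : P → ℝ}
    (ha : ∀ γ, 0 ≤ a γ) (hd : ∀ γ, 0 ≤ d γ) {L : Finset P} {s₀ R₀ : ℝ} (hsR : s₀ < R₀)
    (hhol : ∀ γ ∈ L, LineHolo (fun Q => w Q γ) R₀)
    (hmaj : ∀ Q ∈ ball (0 : Pot) R₀, ∀ γ ∈ L, ‖w Q γ‖ ≤ m γ)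
    (hkp : ∀ γ ∈ L, ∑ γ' ∈ L with inc γ' γ, m γ' * Real.exp (a γ' + d γ') ≤ a γ)
    {𝒞 : Finset (Finset P)} {γ : P} (hγ : γ ∈ L) (hsub : ∀ K ∈ 𝒞, K ⊆ L) (hpin : ∀ K ∈ 𝒞, KPTouches inc K γ)
    {δ : ℝ} (hdec : ∀ K ∈ 𝒞, δ ≤ ∑ γ' ∈ K, d γ') {Q Q' : Pot} (hQ : ‖Q‖ ≤ s₀) (hQ' : ‖Q'‖ ≤ s₀) :
    ‖clusterSum inc (w Q) 𝒞 - clusterSum inc (w Q') 𝒞‖ ≤ 4 * (a γ * Real.exp (-δ)) / (R₀ - s₀) * ‖Q - Q'‖ := by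
  have hϱ : 0 < R₀ - s₀ := sub_pos.mpr hsR
  have hball : ball Q' (R₀ - s₀) ⊆ ball (0 : Pot) R₀ := ball_subset_ball_origin hQ'
  have hQb : Q ∈ ball (0 : Pot) R₀ := mem_ball_zero_iff.2 (lt_of_le_of_lt hQ hsR)
  have hQ'b : Q' ∈ ball (0 : Pot) R₀ := mem_ball_zero_iff.2 (lt_of_le_of_lt hQ' hsR)
  have hKPpt : ∀ p ∈ ball (0 : Pot) R₀, ∀ γ ∈ L,
      ∑ γ' ∈ L with inc γ' γ, ‖w p γ'‖ * Real.exp (a γ' + d γ') ≤ a γ :=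
    fun p hp => kpd_of_norm_le (fun γ hγ => hmaj p hp γ hγ) hkp
  have hsize : ∀ p ∈ ball (0 : Pot) R₀, ‖clusterSum inc (w p) 𝒞‖ ≤ a γ * Real.exp (-δ) :=
    fun p hp => norm_clusterSum_le_of_kp ha hd (hKPpt p hp) hγ hsub hpin hdec
  have henv : 0 ≤ a γ * Real.exp (-δ) := mul_nonneg (ha γ) (Real.exp_nonneg _)
  rcases le_or_gt ‖Q - Q'‖ ((R₀ - s₀) / 2) with hnear | hfar
  · rcases (norm_nonneg (Q - Q')).eq_or_lt with h0 | hr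
    · have hQQ : Q = Q' := sub_eq_zero.1 (norm_eq_zero.1 h0.symm)
      rw [hQQ, sub_self, norm_zero, sub_self, norm_zero, mul_zero]
    · have hRz1 : 1 < (R₀ - s₀) / ‖Q - Q'‖ := by
        rw [one_lt_div hr]; linarith
      have hfit : (R₀ - s₀) / ‖Q - Q'‖ * ‖Q - Q'‖ ≤ R₀ - s₀ := (div_mul_cancel₀ _ hr.ne').le
      have hw : ∀ γ' ∈ L, DifferentiableOn ℂ (fun z : ℂ => w (inputPencil Q Q' z) γ')
          (ball (0 : ℂ) ((R₀ - s₀) / ‖Q - Q'‖)) :=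
        fun γ' hγ' => ((hhol γ' hγ') Q' (Q - Q')).mono fun z hz =>
          hball (inputPencil_mem_ball hϱ hfit (mem_ball_zero_iff.1 hz))
      have hKPz : ∀ z : ℂ, ‖z‖ < (R₀ - s₀) / ‖Q - Q'‖ → ∀ γ ∈ L,
          ∑ γ' ∈ L with inc γ' γ, ‖w (inputPencil Q Q' z) γ'‖ * Real.exp (a γ' + d γ') ≤ a γ :=
        fun z hz => hKPpt _ (hball (inputPencil_mem_ball hϱ hfit hz))
      have key := norm_clusterSum_sub_le_of_family (inc := inc) (w := fun z => w (inputPencil Q Q' z)) ha hd hRz1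
        hw hKPz hγ hsub hpin hdec
      simp only [inputPencil_one, inputPencil_zero] at key
      have hden : 0 < R₀ - s₀ - ‖Q - Q'‖ := by linarith
      have hϱr : (R₀ - s₀ - ‖Q - Q'‖) / ‖Q - Q'‖ = (R₀ - s₀) / ‖Q - Q'‖ - 1 := by
        rw [sub_div, div_self hr.ne']
      calc ‖clusterSum inc (w Q) 𝒞 - clusterSum inc (w Q') 𝒞‖
          ≤ a γ / ((R₀ - s₀) / ‖Q - Q'‖ - 1) * Real.exp (-δ) := key
        _ = a γ * Real.exp (-δ) * ‖Q - Q'‖ / (R₀ - s₀ - ‖Q - Q'‖) := by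
            rw [← hϱr, div_div_eq_mul_div]; ring
        _ ≤ a γ * Real.exp (-δ) * ‖Q - Q'‖ / ((R₀ - s₀) / 2) :=
            div_le_div_of_nonneg_left (mul_nonneg henv (norm_nonneg _)) (by linarith) (by linarith)
        _ = 2 * (a γ * Real.exp (-δ)) / (R₀ - s₀) * ‖Q - Q'‖ := by
            rw [div_div_eq_mul_div]; ring
        _ ≤ 4 * (a γ * Real.exp (-δ)) / (R₀ - s₀) * ‖Q - Q'‖ :=
            mul_le_mul_of_nonneg_right (div_le_div_of_nonneg_right (by linarith) hϱ.le) (norm_nonneg _)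
  · calc ‖clusterSum inc (w Q) 𝒞 - clusterSum inc (w Q') 𝒞‖
        ≤ ‖clusterSum inc (w Q) 𝒞‖ + ‖clusterSum inc (w Q') 𝒞‖ := norm_sub_le _ _
      _ ≤ a γ * Real.exp (-δ) + a γ * Real.exp (-δ) := add_le_add (hsize Q hQb) (hsize Q' hQ'b)
      _ = a γ * Real.exp (-δ) * 2 := by ring
      _ ≤ a γ * Real.exp (-δ) * (4 * ‖Q - Q'‖ / (R₀ - s₀)) := by
          refine mul_le_mul_of_nonneg_left ?_ henv
          rw [le_div_iff₀ hϱ]; linarith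
      _ = 4 * (a γ * Real.exp (-δ)) / (R₀ - s₀) * ‖Q - Q'‖ := by ring

end Gateaux

namespace ClusterGeom

variable {C : Carriers} (G : ClusterGeom C) {Bg : Type} {Pot : Type*} [NormedAddCommGroup Pot] [NormedSpace ℂ Pot]

/-- **POTENTIAL-KPG (HYPOTHESIS SHAPE)** — `PotentialKP` with Fréchet holomorphy of each activity on the ball replaced by
LINE-HOLOMORPHY (`LineHolo`): weaker, and all §3–§4 consequences persist (§8b–§8c).  Printed TYPE as for `PotentialKP`
([II] (2.14)/(2.15) p.15, (2.18) p.16, (2.26) p.17, Lemma 3 (2.38) p.20, for ONE table; the uniformity over the ball is the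
hypothesis displayed — GAPS G-ne9p2-5). [cite: Balaban1988RG2Cluster, (2.14)-(2.15) p.15, (2.38) p.20] -/
def PotentialKPG (W : Set (ℕ → ℝ)) (act : ℕ → ℝ → Bg → Pot → G.P → ℂ) (m : ℕ → ℝ → Bg → G.P → ℝ) (a d : G.P → ℝ)
    (R₀ : ℝ) : Prop :=
  (∀ γ, 0 ≤ a γ) ∧ (∀ γ, 0 ≤ d γ) ∧
    ∀ g ∈ W, ∀ (k : ℕ) (U : Bg) (X : C.Dom), C.scale X = k + 1 →
      (∀ γ ∈ G.vol X, LineHolo (fun Q => act k (g k) U Q γ) R₀) ∧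
      (∀ Q ∈ ball (0 : Pot) R₀, ∀ γ ∈ G.vol X, ‖act k (g k) U Q γ‖ ≤ m k (g k) U γ) ∧
      (∀ γ ∈ G.vol X, ∑ γ' ∈ G.vol X with G.inc γ' γ, m k (g k) U γ' * Real.exp (a γ' + d γ') ≤ a γ)

/-- POTENTIAL-KP ⇒ POTENTIAL-KPG. [folklore] -/
theorem potentialKPG_of_potentialKP {W : Set (ℕ → ℝ)} {act : ℕ → ℝ → Bg → Pot → G.P → ℂ}
    {m : ℕ → ℝ → Bg → G.P → ℝ} {a d : G.P → ℝ} {R₀ : ℝ} (h : G.PotentialKP W act m a d R₀) :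
    G.PotentialKPG W act m a d R₀ := by
  obtain ⟨ha, hd, hP⟩ := h
  refine ⟨ha, hd, fun g hg k U X hX => ?_⟩
  obtain ⟨hhol, hmaj, hkp⟩ := hP g hg k U X hX
  exact ⟨fun γ hγ => lineHolo_of_differentiableOn (hhol γ hγ), hmaj, hkp⟩

/-- **`OutputLipschitz` FROM POTENTIAL-KPG** — `outputLipschitz_of_potentialKP` under the Gâteaux binder, same constant
`4·B₀ k/(R₀ − s₀)`, via `norm_clusterSum_sub_le_of_ballKPG`. [folklore] -/
theorem outputLipschitz_of_potentialKPG {ι : Type} {E : Functional C Bg} {W : Set (ℕ → ℝ)}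
    {T : ℕ → (ℕ → ℝ) → (Bg → C.Dom → ℝ) → ι → ℝ} {Ψ : ℕ → ℝ → (ι → ℝ) → Bg → C.Dom → ℝ}
    {act : ℕ → ℝ → Bg → Pot → G.P → ℂ} {m : ℕ → ℝ → Bg → G.P → ℝ} {a d : G.P → ℝ} {δ : C.Dom → ℝ} {B₀ : ℕ → ℝ}
    {κ s₀ R₀ : ℝ} {wt : ℕ → ι → ℝ} (ρ : ℕ → (ι → ℝ) → Pot) (hKP : G.PotentialKPG W act m a d R₀)
    (hdec : G.DecayExtract δ d) (hpin : G.PinBudget a δ B₀ κ) (hsR : s₀ < R₀)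
    (hρ : ∀ (k : ℕ) (P P' : ι → ℝ) (M : ℝ), (∀ y, |P y - P' y| ≤ wt k y * M) → ‖ρ k P - ρ k P'‖ ≤ M)
    (hΨ : ∀ (k : ℕ) (s : ℝ) (P P' : ι → ℝ) (U : Bg) (X : C.Dom),
      Ψ k s P U X - Ψ k s P' U X = (G.newTerm act k s U X (ρ k P) - G.newTerm act k s U X (ρ k P')).re)
    (hocc : ∀ g ∈ W, ∀ g' ∈ W, ∀ k : ℕ, ‖ρ k (T k g' (E g))‖ ≤ s₀) :
    OutputLipschitz E W T Ψ κ wt (fun k => 4 * B₀ k / (R₀ - s₀)) := by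
  obtain ⟨ha, hd, hP⟩ := hKP
  intro g hg g' hg' k M hM U X hX
  obtain ⟨hhol, hmaj, hkp⟩ := hP g' hg' k U X hX
  have hQQ' : ‖ρ k (T k g' (E g)) - ρ k (T k g' (E g'))‖ ≤ M := hρ k _ _ M hM
  have hϱ : 0 < R₀ - s₀ := sub_pos.mpr hsR
  have key := norm_clusterSum_sub_le_of_ballKPG (inc := G.inc) (w := fun Q => act k (g' k) U Q) ha hd hsR hhol hmaj
    hkp (G.pin_mem X) (G.clus_sub X) (G.clus_pin X) (hdec X) (hocc g hg g' hg' k) (hocc g' hg' g' hg' k)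
  have henv : 0 ≤ B₀ k * Real.exp (-(κ * C.d X)) :=
    le_trans (mul_nonneg (ha _) (Real.exp_nonneg _)) (hpin k X hX)
  rw [hΨ, Complex.sub_re]
  calc |(G.newTerm act k (g' k) U X (ρ k (T k g' (E g)))).re -
          (G.newTerm act k (g' k) U X (ρ k (T k g' (E g')))).re|
        = |(G.newTerm act k (g' k) U X (ρ k (T k g' (E g))) -
            G.newTerm act k (g' k) U X (ρ k (T k g' (E g')))).re| := by rw [Complex.sub_re]
    _ ≤ ‖G.newTerm act k (g' k) U X (ρ k (T k g' (E g))) - G.newTerm act k (g' k) U X (ρ k (T k g' (E g')))‖ :=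
        Complex.abs_re_le_norm _
    _ ≤ 4 * (a (G.pin X) * Real.exp (-(δ X))) / (R₀ - s₀) * ‖ρ k (T k g' (E g)) - ρ k (T k g' (E g'))‖ := key
    _ ≤ 4 * (B₀ k * Real.exp (-(κ * C.d X))) / (R₀ - s₀) * M := by
        have h4 : 0 ≤ 4 * (B₀ k * Real.exp (-(κ * C.d X))) / (R₀ - s₀) := by positivity
        exact mul_le_mul (div_le_div_of_nonneg_right (by linarith [hpin k X hX]) hϱ.le) hQQ' (norm_nonneg _) h4
    _ = Real.exp (-(κ * C.d X)) * (4 * B₀ k / (R₀ - s₀) * M) := by ring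

/-- `OuterLipschitz` from POTENTIAL-KPG (∘ `outerLipschitz_of_factorisation`). [folklore] -/
theorem outerLipschitz_of_potentialKPG {ι : Type} {E : Functional C Bg} {W : Set (ℕ → ℝ)}
    {T : ℕ → (ℕ → ℝ) → (Bg → C.Dom → ℝ) → ι → ℝ} {Ψ : ℕ → ℝ → (ι → ℝ) → Bg → C.Dom → ℝ}
    {act : ℕ → ℝ → Bg → Pot → G.P → ℂ} {m : ℕ → ℝ → Bg → G.P → ℝ} {a d : G.P → ℝ} {δ : C.Dom → ℝ} {B₀ lam : ℕ → ℝ}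
    {κ s₀ R₀ : ℝ} {wt : ℕ → ι → ℝ} (ρ : ℕ → (ι → ℝ) → Pot) (hfac : Factorises E W T Ψ)
    (hlast : LastCouplingLipschitz E W T Ψ κ lam) (hKP : G.PotentialKPG W act m a d R₀) (hdec : G.DecayExtract δ d)
    (hpin : G.PinBudget a δ B₀ κ) (hsR : s₀ < R₀)
    (hρ : ∀ (k : ℕ) (P P' : ι → ℝ) (M : ℝ), (∀ y, |P y - P' y| ≤ wt k y * M) → ‖ρ k P - ρ k P'‖ ≤ M)
    (hΨ : ∀ (k : ℕ) (s : ℝ) (P P' : ι → ℝ) (U : Bg) (X : C.Dom),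
      Ψ k s P U X - Ψ k s P' U X = (G.newTerm act k s U X (ρ k P) - G.newTerm act k s U X (ρ k P')).re)
    (hocc : ∀ g ∈ W, ∀ g' ∈ W, ∀ k : ℕ, ‖ρ k (T k g' (E g))‖ ≤ s₀) :
    OuterLipschitz E W T κ wt lam (fun k => 4 * B₀ k / (R₀ - s₀)) :=
  outerLipschitz_of_factorisation hfac hlast (G.outputLipschitz_of_potentialKPG ρ hKP hdec hpin hsR hρ hΨ hocc)

/-- **NE9 ∧ FADING MEMORY FROM POTENTIAL-KPG with the per-creation-step, sign-guarded channel binders** — the Gâteaux twin of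
`ne9_and_fadingMemory_of_potentialKP_perStep` (∘ `T4HistoryLipschitzRecursion.ne9_and_fadingMemory_of_perStepNN`); the
lineage's most reduced hypothesis list with the weakest activity binder. [folklore] -/
theorem ne9_and_fadingMemory_of_potentialKPG_perStep {ι : Type} {E : Functional C Bg} {W : Set (ℕ → ℝ)}
    {Adm : Set (Bg → C.Dom → ℝ)} {T : ℕ → (ℕ → ℝ) → (Bg → C.Dom → ℝ) → ι → ℝ}
    {Ψ : ℕ → ℝ → (ι → ℝ) → Bg → C.Dom → ℝ} {act : ℕ → ℝ → Bg → Pot → G.P → ℂ} {m : ℕ → ℝ → Bg → G.P → ℝ}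
    {a d : G.P → ℝ} {δ : C.Dom → ℝ} {κ s₀ R₀ B ℓ τbar ω : ℝ} {wt : ℕ → ι → ℝ} {τ : ℕ → ℕ → ℝ} {lam : ℕ → ℝ}
    (ρ : ℕ → (ι → ℝ) → Pot) (h0 : ScaleZeroFree E W) (hAdm : AdmissibleTerms E W Adm) (hres : AdmRestrict Adm)
    (hadd : ChannelAdditive Adm T) (hsum : ChannelStepSum Adm T) (hstep : ChannelSizeAtStepNN Adm T κ wt τ)
    (hfac : Factorises E W T Ψ) (hlast : LastCouplingLipschitz E W T Ψ κ lam) (hKP : G.PotentialKPG W act m a d R₀)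
    (hdec : G.DecayExtract δ d) (hpin : G.PinBudget a δ (fun _ => B) κ) (hsR : s₀ < R₀)
    (hρ : ∀ (k : ℕ) (P P' : ι → ℝ) (M : ℝ), (∀ y, |P y - P' y| ≤ wt k y * M) → ‖ρ k P - ρ k P'‖ ≤ M)
    (hΨ : ∀ (k : ℕ) (s : ℝ) (P P' : ι → ℝ) (U : Bg) (X : C.Dom),
      Ψ k s P U X - Ψ k s P' U X = (G.newTerm act k s U X (ρ k P) - G.newTerm act k s U X (ρ k P')).re)
    (hocc : ∀ g ∈ W, ∀ g' ∈ W, ∀ k : ℕ, ‖ρ k (T k g' (E g))‖ ≤ s₀) (hℓ : 0 ≤ ℓ) (hB : 0 ≤ B) (hτbar : 0 ≤ τbar)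
    (hω : 0 ≤ ω) (hpos : 0 < ω + 4 * B / (R₀ - s₀) * τbar) (hlam : ∀ k, lam k ≤ ℓ)
    (hτ : ∀ k j, j ≤ k → 0 ≤ τ k j ∧ τ k j ≤ τbar * ω ^ (k - j)) :
    NE9 E W κ (prodModuli ℓ fun _ => ω + 4 * B / (R₀ - s₀) * τbar) ∧
      FadingMemory (ℓ / (ω + 4 * B / (R₀ - s₀) * τbar)) (ω + 4 * B / (R₀ - s₀) * τbar)
        (prodModuli ℓ fun _ => ω + 4 * B / (R₀ - s₀) * τbar) :=
  have hc : 0 ≤ 4 * B / (R₀ - s₀) := div_nonneg (mul_nonneg (by norm_num) hB) (sub_pos.mpr hsR).le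
  ne9_and_fadingMemory_of_perStepNN h0 hAdm hres hadd hsum hstep
    (G.outerLipschitz_of_potentialKPG ρ hfac hlast hKP hdec hpin hsR hρ hΨ hocc) hℓ hc hτbar hω hpos hlam
    (fun _ => ⟨hc, le_rfl⟩) hτ

end ClusterGeom

/-! ### §8d Averaged exp-linear activities are line-holomorphic under SCALAR measurability of the functionals -/

section AveragedG

open MeasureTheory

variable {Pot : Type*} [NormedAddCommGroup Pot] [NormedSpace ℂ Pot]
variable {Ω : Type*} [MeasurableSpace Ω]

/-- **Line-holomorphy of an averaged exp-linear activity under weak measurability** (kernel; dominated differentiation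
under the integral sign in ONE complex variable, `hasDerivAt_integral_of_dominated_loc_of_deriv_le`): for an integrable
prefactor, functionals of operator norm `≤ l` with every scalar function `ω ↦ ℓ_ω(Q)` a.e.-strongly measurable, and any
`R₀`, the map `z ↦ ∫ pre(ω)·exp(ℓ_ω(Q₀ + z•V)) dμ(ω)` is complex differentiable on `{z | ‖Q₀ + z•V‖ < R₀}`; dominating
function `‖pre(ω)‖·e^{l R₀}·(l‖V‖)`. [folklore] -/
theorem differentiableOn_integral_const_mul_cexp_line {μ : Measure Ω} {pre : Ω → ℂ} {lin : Ω → (Pot →L[ℂ] ℂ)}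
    {l : ℝ} (hpre : Integrable pre μ) (hlinw : ∀ Q : Pot, AEStronglyMeasurable (fun ω => lin ω Q) μ)
    (hl : ∀ ω, ‖lin ω‖ ≤ l) (R₀ : ℝ) (Q₀ V : Pot) :
    DifferentiableOn ℂ (fun z : ℂ => ∫ ω, pre ω * Complex.exp (lin ω (Q₀ + z • V)) ∂μ)
      {z : ℂ | Q₀ + z • V ∈ ball (0 : Pot) R₀} := by
  intro z₀ hz₀
  have hz₀' : Q₀ + z₀ • V ∈ ball (0 : Pot) R₀ := hz₀
  have hR0 : 0 ≤ R₀ := (norm_nonneg _).trans (mem_ball_zero_iff.1 hz₀').le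
  have hDopen : IsOpen {z : ℂ | Q₀ + z • V ∈ ball (0 : Pot) R₀} :=
    isOpen_ball.preimage (continuous_const.add (continuous_id.smul continuous_const))
  have hDnhds : {z : ℂ | Q₀ + z • V ∈ ball (0 : Pot) R₀} ∈ nhds z₀ := hDopen.mem_nhds hz₀
  have hmeas : ∀ z : ℂ, AEStronglyMeasurable (fun ω => pre ω * Complex.exp (lin ω (Q₀ + z • V))) μ := fun z =>
    hpre.aestronglyMeasurable.mul (Complex.continuous_exp.comp_aestronglyMeasurable (hlinw _))
  have hbd : ∀ z ∈ {z : ℂ | Q₀ + z • V ∈ ball (0 : Pot) R₀}, ∀ ω,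
      ‖pre ω * Complex.exp (lin ω (Q₀ + z • V))‖ ≤ ‖pre ω‖ * Real.exp (l * R₀) :=
    fun z hz ω => norm_const_mul_cexp_le_of_le (hl ω) hR0 hz
  have hlV : ∀ ω, ‖lin ω V‖ ≤ l * ‖V‖ := fun ω =>
    ((lin ω).le_opNorm V).trans (mul_le_mul_of_nonneg_right (hl ω) (norm_nonneg _))
  have key : HasDerivAt (fun z : ℂ => ∫ ω, pre ω * Complex.exp (lin ω (Q₀ + z • V)) ∂μ)
      (∫ ω, pre ω * Complex.exp (lin ω (Q₀ + z₀ • V)) * lin ω V ∂μ) z₀ := by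
    refine (hasDerivAt_integral_of_dominated_loc_of_deriv_le
      (F := fun z ω => pre ω * Complex.exp (lin ω (Q₀ + z • V)))
      (F' := fun z ω => pre ω * Complex.exp (lin ω (Q₀ + z • V)) * lin ω V)
      (bound := fun ω => ‖pre ω‖ * Real.exp (l * R₀) * (l * ‖V‖)) hDnhds ?_ ?_ ?_ ?_ ?_ ?_).2
    · exact Filter.Eventually.of_forall hmeas
    · exact Integrable.mono' (hpre.norm.mul_const _) (hmeas z₀) (Filter.Eventually.of_forall (hbd z₀ hz₀))
    · exact (hmeas z₀).mul (hlinw V)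
    · refine Filter.Eventually.of_forall fun ω z hz => ?_
      rw [norm_mul]
      exact mul_le_mul (hbd z hz ω) (hlV ω) (norm_nonneg _) (mul_nonneg (norm_nonneg _) (Real.exp_pos _).le)
    · exact (hpre.norm.mul_const _).mul_const _
    · refine Filter.Eventually.of_forall fun ω z _ => ?_
      have hlinz : ∀ x : ℂ, lin ω (Q₀ + x • V) = lin ω Q₀ + x * lin ω V := fun x => by
        rw [map_add, map_smul, smul_eq_mul]
      have hg : HasDerivAt (fun x : ℂ => lin ω (Q₀ + x • V)) (lin ω V) z := by
        simp_rw [hlinz]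
        simpa using ((hasDerivAt_id z).mul_const (lin ω V)).const_add (lin ω Q₀)
      have h1 := ((Complex.hasDerivAt_exp _).comp z hg).const_mul (pre ω)
      simpa [Function.comp_def, mul_assoc] using h1
  exact key.differentiableAt.differentiableWithinAt

end AveragedG

namespace ClusterGeom

open MeasureTheory

variable {C : Carriers} (G : ClusterGeom C) {Bg : Type} {Pot : Type*} [NormedAddCommGroup Pot] [NormedSpace ℂ Pot]
variable {Ω : Type*} [MeasurableSpace Ω]

/-- **POTENTIAL-KPG for averaged exp-linear activities under WEAK measurability** (kernel): as `potentialKP_of_avgExpLinear`,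
but the functionals need only be SCALARLY measurable (`ω ↦ ℓ_ω(Q)` a.e.-strongly measurable for every configuration `Q` —
automatic for evaluation functionals at the fluctuation field), and the conclusion is the Gâteaux binder `PotentialKPG`, which
§8b–§8c turn into `OutputLipschitz` / NE9 ∧ FadingMemory exactly as before.  What remains displayed: the `d`-weighted KP
inequality for `∫ ‖pre‖·e^{l R₀} dμ` in every step volume at the occurring couplings (GAPS G-ne9p2-5). [folklore] -/
theorem potentialKPG_of_avgExpLinear {W : Set (ℕ → ℝ)} {μ : ℕ → ℝ → Bg → G.P → Measure Ω}
    {pre : ℕ → ℝ → Bg → G.P → Ω → ℂ} {lin : ℕ → ℝ → Bg → G.P → Ω → (Pot →L[ℂ] ℂ)} {l : ℕ → ℝ → Bg → G.P → ℝ}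
    {a d : G.P → ℝ} {R₀ : ℝ} (ha : ∀ γ, 0 ≤ a γ) (hd : ∀ γ, 0 ≤ d γ) (hR : 0 ≤ R₀)
    (hpre : ∀ k s U γ, Integrable (pre k s U γ) (μ k s U γ))
    (hlinw : ∀ k s U γ (Q : Pot), AEStronglyMeasurable (fun ω => lin k s U γ ω Q) (μ k s U γ))
    (hl : ∀ k s U γ ω, ‖lin k s U γ ω‖ ≤ l k s U γ)
    (hkp : ∀ g ∈ W, ∀ (k : ℕ) (U : Bg) (X : C.Dom), C.scale X = k + 1 → ∀ γ ∈ G.vol X,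
      ∑ γ' ∈ G.vol X with G.inc γ' γ, G.avgExpLinearMajorant μ pre l R₀ k (g k) U γ' * Real.exp (a γ' + d γ') ≤ a γ) :
    G.PotentialKPG W (G.avgExpLinearAct μ pre lin) (G.avgExpLinearMajorant μ pre l R₀) a d R₀ := by
  refine ⟨ha, hd, fun g hg k U X hX => ⟨?_, ?_, hkp g hg k U X hX⟩⟩
  · intro γ _ Q₀ V
    exact differentiableOn_integral_const_mul_cexp_line (hpre k (g k) U γ) (hlinw k (g k) U γ) (hl k (g k) U γ) R₀ Q₀ V
  · intro Q hQ γ _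
    exact norm_integral_const_mul_cexp_le (hpre k (g k) U γ) (hl k (g k) U γ) hR hQ

end ClusterGeom

/-! ### §8e (v1.3) Evaluation-type functionals on a table space of bounded continuous functions satisfy §8d's hypotheses
The §8 header asserts that the scalar-measurability hypothesis of `potentialKPG_of_avgExpLinear` is automatic for
EVALUATION-TYPE functionals `T ↦ Σ_Y c_ω(Y)·T(pt_ω(Y))` (finitely many evaluations of the table at field-dependent points,
with field-dependent coefficients).  §8e makes this a kernel statement for the table space `S →ᵇ ℂ` of bounded continuous
functions on a topological space `S` of field configurations (any topology; Borel-measurable evaluation points):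
`evalFunctional`, its operator-norm bound `Σ_Y ‖c(Y)‖`, the scalar measurability of `ω ↦ ℓ_ω(T)`, and the resulting
POTENTIAL-KPG for averaged exp-EVALUATION activities (`potentialKPG_of_avgEvalExpLinear`), whose remaining hypotheses are:
integrable prefactors, measurable coefficients / evaluation points with `Σ_Y ‖c_ω(Y)‖ ≤ l`, `0 ≤ R₀`, and the displayed KP
inequality for `∫ ‖pre‖·e^{l R₀} dμ` (GAPS G-ne9p2-5 (i)). [folklore] -/

section EvalFunctionals

open MeasureTheory BoundedContinuousFunction

variable {S : Type*} [TopologicalSpace S] {F : Type*} [Fintype F]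

/-- EVALUATION-TYPE functional on the table space `S →ᵇ ℂ`: `T ↦ Σ_{Y} c(Y)·T(pt Y)`. [folklore] -/
def evalFunctional (c : F → ℂ) (pt : F → S) : (S →ᵇ ℂ) →L[ℂ] ℂ :=
  ∑ Y, c Y • BoundedContinuousFunction.evalCLM ℂ (pt Y)

/-- pointwise formula of an evaluation-type functional. [folklore] -/
theorem evalFunctional_apply (c : F → ℂ) (pt : F → S) (T : S →ᵇ ℂ) :
    evalFunctional c pt T = ∑ Y, c Y * T (pt Y) := by
  simp [evalFunctional, smul_eq_mul]

/-- operator norm of an evaluation-type functional `≤ Σ_Y ‖c(Y)‖`. [folklore] -/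
theorem norm_evalFunctional_le (c : F → ℂ) (pt : F → S) : ‖evalFunctional c pt‖ ≤ ∑ Y, ‖c Y‖ := by
  refine ContinuousLinearMap.opNorm_le_bound _ (Finset.sum_nonneg fun _ _ => norm_nonneg _) fun T => ?_
  rw [evalFunctional_apply, Finset.sum_mul]
  refine (norm_sum_le _ _).trans (Finset.sum_le_sum fun Y _ => ?_)
  rw [norm_mul]
  exact mul_le_mul_of_nonneg_left (T.norm_coe_le_norm (pt Y)) (norm_nonneg _)

variable [MeasurableSpace S] [OpensMeasurableSpace S] {Ω : Type*} [MeasurableSpace Ω]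

/-- SCALAR MEASURABILITY of evaluation-type functionals: for measurable coefficients and measurable evaluation points,
`ω ↦ ℓ_ω(T)` is a.e.-strongly measurable for every bounded continuous table `T` (no measurability of `ω ↦ ℓ_ω` in operator
norm is claimed or needed). [folklore] -/
theorem aestronglyMeasurable_evalFunctional_apply {μ : Measure Ω} {c : Ω → F → ℂ} {pt : Ω → F → S}
    (hc : ∀ Y, AEStronglyMeasurable (fun ω => c ω Y) μ) (hpt : ∀ Y, Measurable fun ω => pt ω Y) (T : S →ᵇ ℂ) :
    AEStronglyMeasurable (fun ω => evalFunctional (c ω) (pt ω) T) μ := by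
  simp_rw [evalFunctional_apply]
  refine Finset.aestronglyMeasurable_fun_sum _ fun Y _ => (hc Y).mul ?_
  exact (T.continuous.measurable.comp (hpt Y)).aestronglyMeasurable

end EvalFunctionals

namespace ClusterGeom

open MeasureTheory BoundedContinuousFunction

variable {C : Carriers} (G : ClusterGeom C) {Bg : Type} {S : Type*} [TopologicalSpace S] [MeasurableSpace S]
  [OpensMeasurableSpace S] {F : Type*} [Fintype F] {Ω : Type*} [MeasurableSpace Ω]

/-- **POTENTIAL-KPG for averaged exp-EVALUATION activities** (kernel; `potentialKPG_of_avgExpLinear` with the functionals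
specialised to evaluation type on the table space `S →ᵇ ℂ`): activities
`Q ↦ ∫ pre(ω)·exp(Σ_Y c_ω(Y)·Q(pt_ω(Y))) dμ(ω)` with integrable prefactors, measurable coefficients and evaluation points,
`Σ_Y ‖c_ω(Y)‖ ≤ l`, satisfy POTENTIAL-KPG on the ball of radius `R₀ ≥ 0` with majorant `∫ ‖pre‖·e^{l R₀} dμ`, GIVEN the
displayed KP inequality for that majorant (GAPS G-ne9p2-5 (i)).  All analytic-regularity hypotheses of the activity binder are
thereby discharged by construction for this table space. [folklore] -/
theorem potentialKPG_of_avgEvalExpLinear {W : Set (ℕ → ℝ)} {μ : ℕ → ℝ → Bg → G.P → Measure Ω}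
    {pre : ℕ → ℝ → Bg → G.P → Ω → ℂ} {c : ℕ → ℝ → Bg → G.P → Ω → F → ℂ} {pt : ℕ → ℝ → Bg → G.P → Ω → F → S}
    {l : ℕ → ℝ → Bg → G.P → ℝ} {a d : G.P → ℝ} {R₀ : ℝ} (ha : ∀ γ, 0 ≤ a γ) (hd : ∀ γ, 0 ≤ d γ) (hR : 0 ≤ R₀)
    (hpre : ∀ k s U γ, Integrable (pre k s U γ) (μ k s U γ))
    (hc : ∀ k s U γ Y, AEStronglyMeasurable (fun ω => c k s U γ ω Y) (μ k s U γ))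
    (hpt : ∀ k s U γ Y, Measurable fun ω => pt k s U γ ω Y)
    (hl : ∀ k s U γ ω, ∑ Y, ‖c k s U γ ω Y‖ ≤ l k s U γ)
    (hkp : ∀ g ∈ W, ∀ (k : ℕ) (U : Bg) (X : C.Dom), C.scale X = k + 1 → ∀ γ ∈ G.vol X,
      ∑ γ' ∈ G.vol X with G.inc γ' γ, G.avgExpLinearMajorant μ pre l R₀ k (g k) U γ' * Real.exp (a γ' + d γ') ≤ a γ) :
    G.PotentialKPG W (G.avgExpLinearAct μ pre (fun k s U γ ω => evalFunctional (c k s U γ ω) (pt k s U γ ω)))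
      (G.avgExpLinearMajorant μ pre l R₀) a d R₀ :=
  G.potentialKPG_of_avgExpLinear ha hd hR hpre
    (fun k s U γ Q => aestronglyMeasurable_evalFunctional_apply (hc k s U γ) (hpt k s U γ) Q)
    (fun k s U γ ω => (norm_evalFunctional_le _ _).trans (hl k s U γ ω)) hkp

end ClusterGeom

end Literature.MathematicalPhysics.QuantumFieldTheory.Balaban1983to89.T4HistoryLipschitzActivity

end
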